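import Literature.NumberTheory.EllipticCurves.BSDSelmerCMPConverseHeegnerFieldProofs
import Literature.NumberTheory.EllipticCurves.BSDSelmerCMPConverseGoldfeldProofs
import Literature.NumberTheory.EllipticCurves.BSDSelmerCMPConverseRankOneProofs
import Literature.NumberTheory.EllipticCurves.CMModPImageNotSurjectiveProofs
import Literature.NumberTheory.EllipticCurves.CyclotomicIwasawaMainTheoremIrreducibleBaseChangeProofs
import Literature.NumberTheory.EllipticCurves.LFunctionSmulProofs
import Literature.NumberTheory.EllipticCurves.QuadraticTwistSelmerPInfty
import Literature.NumberTheory.QuadraticFields.FundamentalDiscriminant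
import Literature.NumberTheory.EllipticCurves.SelmerParityTotallyReal
import HarnessLib

/-!
# The corank-one `p`-converse for CM curves over a quadratic field, from Burungale–Tian's two
# theorems over `ℚ` — and the `K`-level leaf of route B is not smaller than the fact

Fourth *proofs* companion (theorems only: no definition, no named fact, no instance; D-0014 /
D-0026) of `Literature.NumberTheory.EllipticCurves.BSDSelmerCMPConverse`, for its named fact
`Literature.NumberTheory.EllipticCurves.burungaleTian_analyticRank_eq_one_of_selmerCorank_eq_one_of_hasCM`
(A. A. Burungale, Y. Tian, *`p`-converse to a theorem of Gross–Zagier, Kolyvagin and Rubin*,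
Invent. Math. 220 (2020), 211–253, **Theorem 1.2** (p. 214): for a CM elliptic curve `E/ℚ` and a
good ordinary prime `p > 3`, `corank_{ℤ_p} Sel_{p^∞}(E/ℚ) = 1 ⟹ ord_{s=1} L(s, E/ℚ) = 1`).

## What is proved (the converse direction of route B)

`BSDSelmerCMPConverseHeegnerFieldProofs` ("route B") proves the fact from the `p`-parity theorem,
the Modularity Theorem, Hoffstein–Luo, Kato's finiteness theorem and ONE inline `K`-level leaf
`hBCGS` — Burungale–Castella–Grossi–Skinner, Camb. J. Math. 14 (2026) = arXiv:2312.09301, §0.1,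
Thm. 1 + Cor. 1, rank-one case: for `E/ℚ`, `p > 3` good ordinary with (irr), `K` imaginary
quadratic with (Heeg), (disc), (tor), `p` split, `corank_{ℤ_p} Sel_{p^∞}(E/K) = 1 ⟹
ord_{s=1} L(E/K, s) = 1` — applied only ever to the CM curve itself. This file runs the deduction
BACKWARDS and shows that, for CM curves, that `K`-level statement is already a consequence of
Burungale–Tian's two theorems over `ℚ` — the rank-one fact above and the rank-zero `p`-converse
`Literature.NumberTheory.EllipticCurves.burungaleTian_analyticRank_eq_zero_of_selmerCorank_eq_zero_of_hasCM`
(Burungale–Tian, Ann. of Math. 203 (2026), Thm. 1.1: CM `E/ℚ`, ANY prime `p`,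
`corank_{ℤ_p} Sel_{p^∞}(E/ℚ) = 0 ⟹ ord_{s=1} L(E, s) = 0`) — together with the analytic
continuation of `L(E, s)` (modularity), and in fact in a STRONGER form: over every quadratic field
`K` (real or imaginary, no Heegner hypothesis, no (disc), no (tor), no (irr)) unramified at `p`.

* `analyticRankEK_eq_one_of_hasCM_of_selmerCorank_baseChange_eq_one_of_burungaleTian`
  (**proved**): the two Burungale–Tian facts + `hasEntireLFunction_rat` give, for `E/ℚ` with CM
  (globally minimal `W`), `p ≥ 5` good ordinary, `K` quadratic with `p ∤ d_K`:
  `corank_{ℤ_p} Sel_{p^∞}(E/K) = 1 ⟹ ord_{s=1} L(E/K, s) = 1`. Proof: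
  `corank Sel_{p^∞}(E/K) = corank Sel_{p^∞}(E/ℚ) + corank Sel_{p^∞}(E^{(d_K)}/ℚ)` (Dokchitser–
  Dokchitser 2010, Lemma 4.14; tree THEOREM `selmerCorank_baseChange_quadratic_holds`) and
  `ord L(E/K) = ord L(E) + ord L(E^{(d_K)})` (`analyticRankEK_eq_add_of`), so the coranks are
  `(1, 0)` or `(0, 1)`. In the first case the rank-one fact for `E` and the rank-zero fact for the
  CM curve `E^{(d_K)}` (`hasCM_quadraticTwist_of_hasCM`; the rank-zero fact needs no reduction
  hypothesis and no minimal model) give `1 + 0`. In the second, the rank-zero fact for `E` gives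
  `ord L(E) = 0`, and the rank-one fact is applied to a GLOBALLY MINIMAL model `W'` of the CM twist
  `E^{(m)} ≅ E^{(d_K)}`, `d_K ∈ {m, 4m}` with `m` squarefree (`isFundamentalDiscriminant_discr`,
  `exists_variableChange_quadraticTwist_mul_sq`, `exists_isGloballyMinimal_smul_eq_quadraticTwist`;
  CM is an isomorphism invariant through `j`, `hasCM_iff_j_mem_of_heegnerStarkPrime`), which is
  again good ordinary at `p` because `p ∤ 2m` (`isOrdinaryAt_of_smul_eq_quadraticTwist`:
  `a_p(E^{(m)}) = (m/p) a_p(E)`, Knapp Prop. 12.10), has `corank 1`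
  (`selmerCorank_eq_of_variableChange`) and the same analytic rank (`analyticRank_smul`).
* `bcgsLeaf_of_hasCM_of_burungaleTian` (**proved**): in particular the `hBCGS` display restricted
  to CM curves (its hypotheses (irr), (Heeg), (disc), (tor) being simply dropped, and `p` split in
  `K` giving `p ∤ d_K`).
* `bcgsLeaf_of_not_hasCM_of_burungaleTian` (**proved**): hence the full inline leaf `hBCGS` of
  `BSDSelmerPConverseYanZhuProofs` (all `E/ℚ`) follows from its restriction to NON-CM curves plus
  Burungale–Tian's two facts — the bsd.S25 cluster need only ever vendor Burungale–Castella–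
  Grossi–Skinner's Cor. 1 for curves without complex multiplication (the setting in which its
  Kolyvagin-system inputs are classical), the CM case being Burungale–Tian's.
* `analyticRank_eq_one_of_hasCM_of_bcgsCM_of_rootNumber_eq_neg_one`,
  `burungaleTian_analyticRank_eq_one_of_selmerCorank_eq_one_of_hasCM_of_bcgsCM` (**proved**):
  route B verbatim with the leaf restricted to CM curves (the proof of
  `analyticRank_eq_one_of_hasCM_of_bcgs_of_rootNumber_eq_neg_one` applies `hBCGS` to the CM curve
  only).
* `burungaleTian_analyticRank_eq_one_iff_bcgsCM_of_facts` (**proved**): modulo the common leaves of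
  the cluster — Burungale–Tian's rank-zero fact, the `p`-parity fact, the Modularity Theorem,
  Hoffstein–Luo and Kato — Burungale–Tian's Thm. 1.2 is EQUIVALENT to the CM-restricted `K`-level
  leaf. So vendoring "BCGS Cor. 1 for CM curves" as a named fact would not lower the debt behind
  `…_of_hasCM`: over CM curves the `K`-level rank-one `p`-converse and the `ℚ`-level one are the
  same theorem up to the rank-zero `p`-converse.

* `not_hasSurjectiveModNGaloisRep_of_hasCM_of_not_dvd_frobeniusTrace` (**proved**, Serre 1972
  §4.5 made effective at ordinary primes): a CM curve has NON-surjective `ρ̄_{E,p}` at every good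
  ordinary `p > 3` (the twisted `√D` visible on `E[p]` has `p ∤ D`, so the image normalises a
  Cartan subgroup and misses the transvection `(1 1; 0 1)`); hence
  `yanZhu_analyticRank_eq_one_of_selmerCorank_eq_one_of_bcgsNonCM` (**proved**): Yan–Zhu's
  Cor. 1.4 (`yanZhu_analyticRank_eq_one_of_selmerCorank_eq_one`, surjective `ρ̄_{E,p}`) already
  follows from the NON-CM half of the leaf. The one inline leaf of the bsd.S25 cluster thus
  splits along CM / non-CM into a half equivalent to Burungale–Tian's theorems and a half that
  alone carries the big-image corollaries.

* `smul_eq_self_or_eq_zero_of_hasCM_of_modPCyclotomicCharacterZMod_eq_one`,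
  `not_exists_fixed_ne_zero_and_smul_ne_of_hasCM` (**proved**, Part 6): at a good ordinary
  `p > 3`, an element of `Γ_{ℚ(μ_p)}` acts on the `p`-torsion of a CM curve either TRIVIALLY or
  WITHOUT NON-ZERO FIXED POINTS (an element of determinant `1` of the normaliser of a Cartan
  subgroup `𝔽_p[Φ]ˣ`, `Φ² = D ∈ 𝔽_pˣ`, is `1` or has `det(M - 1) ∈ {2 - 2a ≠ 0, 2}`:
  `eq_one_or_det_sub_one_ne_zero_of_cartanNormalizer`). So no `σ ∈ Γ_{ℚ(μ_{p^∞})}` has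
  `T_pE/(σ - 1)T_pE ≃ ℤ_p` (mod `p` its coinvariants on `E[p]` would be a line): the hypothesis
  (im) of Burungale–Castella–Skinner's Thms. 1.1.2 (b) / 1.2.2 (b) (IMRN 2025, Rem. 1.1.3: "for
  non-CM curves (im) holds for all sufficiently large `p`"; Rem. 1.2.3: "(b) excludes the
  residually dihedral primes") — Mazur–Rubin's transversality hypothesis on `τ`, used for Kato's
  Kolyvagin system in BCGS's Thm. 3 ("without CM", the `τ` coming "by Serre's open image
  theorem", arXiv:2312.09301 p. 23) — FAILS for every CM curve at every good ordinary `p > 3`,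
  complementing the non-surjectivity of Part 5. Only the `Λ ⊗ ℚ_p`-parts (a) of those theorems,
  printed under (irr_ℚ) alone, can ever be fed a CM curve.

* `analyticRank_eq_one_of_hasCM_of_bcgsCM_of_coatesWiles_rubin_of_rootNumber_eq_neg_one`,
  `burungaleTian_analyticRank_eq_one_of_selmerCorank_eq_one_of_hasCM_of_bcgsCM_of_cmFacts`,
  `burungaleTian_analyticRank_eq_one_iff_bcgsCM_of_cmFacts` (**proved**, Part 7): route B for CM
  curves on the CLASSICAL CM inputs — the rank-zero step at the (CM) twist `E^{(d_K)}` by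
  Coates–Wiles 1977 + Rubin 1987 (tree facts `finite_point_of_hasCM_of_L_one_ne_zero`,
  `shaFinite_of_hasCM_of_L_one_ne_zero`) instead of Kato, as in the printed proof (display (4.4):
  the rank-zero factor by Rubin's main conjecture [38, Thm. 11.1]), and parity only at CM curves
  and good ordinary `p ≥ 5` (display (4.2), Nekovář [31, Thm. A′]). Modulo Burungale–Tian's
  rank-zero fact, CM parity, modularity, Hoffstein–Luo, Coates–Wiles and Rubin 1987 the fact ⟺ the
  CM-restricted `K`-level leaf: neither Kato's theorem nor parity off the CM locus is an input of
  the CM route.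

* `hparCM_of_nekovar`, `hpar_of_nekovar`,
  `burungaleTian_analyticRank_eq_one_of_selmerCorank_eq_one_of_hasCM_of_bcgsCM_of_nekovar`,
  `burungaleTian_analyticRank_eq_one_iff_bcgsCM_of_nekovar` (**proved**, Part 8): the parity
  hypothesis of Parts 3 and 7 discharged from the tree's named fact `Nekovar2013_theoremA`
  (`SelmerParityTotallyReal`: J. Nekovář, Algebra & Number Theory 7 (2013), Thm. A, whose case
  `F = ℚ` is the `p`-parity theorem for every `E/ℚ` and every `p`) and the Modularity Theorem — the
  printed proof takes its parity step (4.2) "from the parity conjecture due to Nekovář [31,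
  Thm. A′]" (p. 249; p. 217: "In this case, the parity conjecture is due to Nekovář [31]"). So
  route B for CM curves runs on named facts of the tree for every `ℚ`-level input — Nekovář's
  parity theorem, modularity, Hoffstein–Luo, Coates–Wiles, Rubin 1987 — plus the CM-restricted
  `K`-level leaf.

Nothing is asserted: every deep input enters as a hypothesis (a named fact of the tree or the
inline display), and the new content is the elementary twist bookkeeping of the first bullet and
the image computations of Parts 5–6.

## References

* [BurungaleTian2019] A. A. Burungale, Y. Tian, Invent. Math. 220 (2020), Thm. 1.2 (p. 214).
* [BurungaleTian2026] A. A. Burungale, Y. Tian, Ann. of Math. (2) 203 (2026), Thm. 1.1 (p. 1).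
* [BurungaleEtAl2026] A. Burungale, F. Castella, G. Grossi, C. Skinner, Camb. J. Math. 14 (2026)
  = arXiv:2312.09301, §0.1, Thm. 1, Cor. 1 (pp. 3–4 of the held text; Thm. 3 ibid. is the one
  printed "without CM").
* [DokchitserDokchitserAnnals2010] T. Dokchitser, V. Dokchitser, Ann. of Math. 172 (2010),
  Lemma 4.14 (the corank of `Sel_{p^∞}` over a quadratic extension).
* [Knapp1993] A. W. Knapp, *Elliptic Curves*, Prop. 12.10 (`a_p` of a quadratic twist);
  [SilvermanAEC2009] VIII.8 Cor. 8.3 (global minimal models over `ℚ`), X.§4, App. C §11 and §16.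
* [Serre1972] J.-P. Serre, Invent. Math. 15 (1972), §4.5 (CM images normalise a Cartan
  subgroup), §2.2, §1.11; [Lang1987] S. Lang, *Elliptic Functions*, Ch. 10 §4.
* [YanZhu2024MainConjNonCM] X. Yan, X. Zhu, arXiv:2412.20078, Cor. 1.4 and Thm. 4.15 (§4.6).
* [BurungaleCastellaSkinner2025] A. Burungale, F. Castella, C. Skinner, IMRN 2025 =
  arXiv:2405.00270, Thm. 1.1.2, Rem. 1.1.3, Thm. 1.2.2, Rem. 1.2.3 (hypotheses (irr_ℚ), (im),
  (sur); pp. 2–3 of the held text).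
* [MazurRubin2004] B. Mazur, K. Rubin, *Kolyvagin systems*, Mem. AMS 168 (2004), §3.5
  (the hypothesis "`T/(τ - 1)T` free of rank one" on the Galois image).
* [CoatesWiles1977] J. Coates, A. Wiles, Invent. Math. 39 (1977), Thm. 1; [Rubin1987Sha] K. Rubin,
  Invent. Math. 89 (1987), Thm. A (p. 527) and §0 Remark (3) (p. 528); [Greenberg1999LNM]
  R. Greenberg, LNM 1716 (1999), §1 p. 54 (the rank-zero step of Part 7).
* [Nekovar2013] J. Nekovář, *Some consequences of a formula of Mazur and Rubin for arithmetic local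
  constants*, Algebra & Number Theory 7:5 (2013) 1101–1120, Thm. A (p. 1101) — the tree's parity
  fact `Nekovar2013_theoremA` (Part 8); the printed citation of Burungale–Tian's (4.2) is
  [31] = J. Nekovář, *On the parity of ranks of Selmer groups. II*, C. R. Acad. Sci. Paris Sér. I
  Math. 332 (2001), Thm. A′.
-/

noncomputable section

open scoped Classical

open WeierstrassCurve Literature.NumberTheory.QuadraticFields.BinaryQuadraticForm

namespace Literature.NumberTheory.EllipticCurves

/-! ## Part 1. An odd quadratic discriminant is squarefree -/

/-- The discriminant of a quadratic field, when odd, is squarefree: a fundamental discriminant is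
either `≡ 1 (mod 4)` and squarefree or of the form `4m` (tree theorem
`isFundamentalDiscriminant_discr`; Marcus, *Number Fields*, Ch. 2 Thm. 1), and the second shape is
even. [folklore] -/
theorem squarefree_discr_of_odd {K : Type*} [Field K] [NumberField K]
    (h2 : Module.finrank ℚ K = 2) (hodd : Odd (NumberField.discr K)) :
    Squarefree (NumberField.discr K) := by
  rcases Literature.NumberTheory.QuadraticFields.Quadratic.isFundamentalDiscriminant_discr
      (K := K) h2 with ⟨-, hsq, -⟩ | ⟨h4, -, -⟩
  · exact hsq
  · exfalso
    obtain ⟨k, hk⟩ := h4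
    rw [Int.odd_iff] at hodd
    omega

/-! ## Part 2. The `K`-level corank-one `p`-converse for CM curves from the two `ℚ`-level ones -/

section KLevel

/-- **The corank-one `p`-converse for a CM curve over a quadratic field, from Burungale–Tian's
two theorems over `ℚ`.** Let `E/ℚ` have complex multiplication (globally minimal `W`), let
`p ≥ 5` be a prime of good ordinary reduction, and let `K` be ANY quadratic field unramified at
`p` (`p ∤ d_K`; real or imaginary). Assume Burungale–Tian's rank-one `p`-converse (`h1`, Invent.
Math. 220 (2020) Thm. 1.2, the tree's named fact), their rank-zero `p`-converse (`h0`, Ann. of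
Math. 203 (2026) Thm. 1.1: CM, any prime, corank `0 ⟹ ord 0`) and the analytic continuation of
`L(E', s)` for elliptic `E'/ℚ` (`hE`, modularity). Then
`corank_{ℤ_p} Sel_{p^∞}(E/K) = 1 ⟹ ord_{s=1} L(E/K, s) = 1` (`analyticRankEK`, the order of
`L(E, s) L(E^{(d_K)}, s)` at `s = 1`). Proof: by Dokchitser–Dokchitser's Lemma 4.14
(`selmerCorank_baseChange_quadratic_holds`) the corank over `K` is `corank(E) + corank(E^{(d_K)})`,
so the pair is `(1, 0)` or `(0, 1)`; `ord L(E/K) = ord L(E) + ord L(E^{(d_K)})`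
(`analyticRankEK_eq_add_of`). Case `(1, 0)`: `h1` for `E` and `h0` for the CM curve `E^{(d_K)}`
(`hasCM_quadraticTwist_of_hasCM`). Case `(0, 1)`: `h0` for `E`; write `d_K = m` or `4m` with `m`
squarefree (`isFundamentalDiscriminant_discr`), so that `E^{(d_K)} ≅ E^{(m)}` over `ℚ`
(`exists_variableChange_quadraticTwist_mul_sq`) and `p ∤ m`; then `h1` for a globally minimal
model `W'` of `E^{(m)}` (`exists_isGloballyMinimal_smul_eq_quadraticTwist`), which has CM (`j` is an
isomorphism invariant, `hasCM_iff_j_mem_of_heegnerStarkPrime`), is good ordinary at `p` since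
`p ∤ 2m` (`isOrdinaryAt_of_smul_eq_quadraticTwist`: `a_p(E^{(m)}) = (m/p) a_p(E)`), and has corank
`1` (`selmerCorank_eq_of_variableChange`) and the analytic rank of `E^{(d_K)}` (`analyticRank_smul`).
No Heegner hypothesis, no torsion or image hypothesis. [cite: BurungaleTian2019, Thm. 1.2 (p. 214)]
[cite: BurungaleTian2026, Thm. 1.1] [cite: DokchitserDokchitserAnnals2010, Lemma 4.14]
[cite: Knapp1993, Prop. 12.10] -/
theorem analyticRankEK_eq_one_of_hasCM_of_selmerCorank_baseChange_eq_one_of_burungaleTian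
    (h1 : burungaleTian_analyticRank_eq_one_of_selmerCorank_eq_one_of_hasCM)
    (h0 : burungaleTian_analyticRank_eq_zero_of_selmerCorank_eq_zero_of_hasCM)
    (hE : hasEntireLFunction_rat)
    (W : WeierstrassCurve ℚ) [W.IsElliptic] [W.IsGloballyMinimal] (hCM : W.HasCM)
    (p : ℕ) [Fact p.Prime] (hp : 5 ≤ p) (hgood : W.HasGoodReductionAtPrime p)
    (hord : ¬ (p : ℤ) ∣ W.frobeniusTrace p)
    (K : Type) [Field K] [NumberField K] (h2 : Module.finrank ℚ K = 2)
    (hpd : ¬ (p : ℤ) ∣ NumberField.discr K) (h : (W.baseChange K).selmerCorank p = 1) :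
    analyticRankEK W K = 1 := by
  have hd0 : ((NumberField.discr K : ℤ) : ℚ) ≠ 0 := by
    exact_mod_cast NumberField.discr_ne_zero K
  haveI := W.isElliptic_quadraticTwist hd0
  -- the CM twist
  have hCMd : (W.quadraticTwist (NumberField.discr K : ℚ)).HasCM :=
    hasCM_quadraticTwist_of_hasCM W hCM hd0
  -- the two splittings
  rw [selmerCorank_baseChange_quadratic_holds W K h2 p] at h
  rw [analyticRankEK_eq_add_of hE W K]
  rcases Nat.eq_zero_or_pos (W.selmerCorank p) with hW0 | hWpos
  · -- case `(0, 1)`: the twist carries the corank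
    rw [hW0, zero_add] at h
    have hA0 : W.analyticRank = 0 := h0 W hCM p hW0
    -- `d_K = m` or `4m` with `m` squarefree, `p ∤ m`, and `E^{(d_K)} ≅ E^{(m)}` over `ℚ`
    obtain ⟨m, hsq, hpm, hm0, C₁, hC₁⟩ : ∃ m : ℤ, Squarefree m ∧ ¬ (p : ℤ) ∣ m ∧ (m : ℚ) ≠ 0 ∧
        ∃ C₁ : VariableChange ℚ,
          C₁ • W.quadraticTwist (m : ℚ) = W.quadraticTwist (NumberField.discr K : ℚ) := by
      rcases Literature.NumberTheory.QuadraticFields.Quadratic.isFundamentalDiscriminant_discr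
          (K := K) h2 with ⟨-, hsqD, -⟩ | ⟨h4, -, hsq4⟩
      · exact ⟨NumberField.discr K, hsqD, hpd, hd0, 1, one_smul _ _⟩
      · obtain ⟨m, hm⟩ := h4
        have hm' : NumberField.discr K / 4 = m := by
          rw [hm]; exact Int.mul_ediv_cancel_left m (by norm_num)
        have hmne : m ≠ 0 := by
          rintro rfl
          exact NumberField.discr_ne_zero K (by rw [hm]; norm_num)
        refine ⟨m, hm' ▸ hsq4, fun hpm ↦ hpd (hm ▸ Dvd.dvd.mul_left hpm 4), by exact_mod_cast hmne,
          ?_⟩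
        obtain ⟨C, hC⟩ := W.exists_variableChange_quadraticTwist_mul_sq (m : ℚ) 2 two_ne_zero
        refine ⟨C, ?_⟩
        rw [hC, hm]
        congr 1
        push_cast
        ring
    -- a globally minimal model `W'` of `E^{(m)}`, isomorphic to `E^{(d_K)}`
    haveI := W.isElliptic_quadraticTwist hm0
    obtain ⟨W', _, _, C₂, hC₂⟩ := exists_isGloballyMinimal_smul_eq_quadraticTwist W hm0
    have hC : (C₁ * C₂) • W' = W.quadraticTwist (NumberField.discr K : ℚ) := by
      rw [mul_smul, hC₂, hC₁]
    -- `W'` has CM (through `j`)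
    have hiff := hasCM_iff_j_mem_of_heegnerStarkPrime HeegnerStarkPrimeThreeModEight_holds
    have hCM' : W'.HasCM := by
      have h' : ((C₁ * C₂) • W').HasCM := by rw [hC]; exact hCMd
      have hj : ((C₁ * C₂) • W').j ∈ cmJInvariants := (hiff ((C₁ * C₂) • W')).1 h'
      rw [W'.variableChange_j (C₁ * C₂)] at hj
      exact (hiff W').2 hj
    -- `W'` is good ordinary at `p` (`m` squarefree, `p ∤ 2m`)
    have hp2 : p ≠ 2 := by omega
    have hord' : IsOrdinaryAt W' p :=
      isOrdinaryAt_of_smul_eq_quadraticTwist W W' hsq hC₂ p hp2 hpm ⟨hgood, hord⟩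
    -- corank and analytic rank of `W'`
    have hc' : W'.selmerCorank p = 1 := by
      rw [selmerCorank_eq_of_variableChange p hC]; exact h
    have hA' : W'.analyticRank = 1 := h1 W' hCM' p hp hord'.1 hord'.2 hc'
    have hAt : (W.quadraticTwist (NumberField.discr K : ℚ)).analyticRank = 1 := by
      rw [← hC, W'.analyticRank_smul (C₁ * C₂)]; exact hA'
    rw [hA0, hAt]
  · -- case `(1, 0)`: `E` carries the corank
    have hW1 : W.selmerCorank p = 1 := by omega
    have ht0 : (W.quadraticTwist (NumberField.discr K : ℚ)).selmerCorank p = 0 := by omega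
    rw [h1 W hCM p hp hgood hord hW1, h0 _ hCMd p ht0]

/-- **Under `p` split in `K`: the same, with `p ∤ d_K` read off the splitting** (`p` split in the
quadratic field `K`, `SatisfiesHeegnerHypothesis p K`, forces `p` unramified:
`Literature.SatisfiesHeegnerHypothesis.not_dvd_discr`). [cite: BurungaleTian2019, Thm. 1.2 (p. 214)]
[cite: BurungaleTian2026, Thm. 1.1] -/
theorem analyticRankEK_eq_one_of_hasCM_of_selmerCorank_baseChange_eq_one_of_split_of_burungaleTian
    (h1 : burungaleTian_analyticRank_eq_one_of_selmerCorank_eq_one_of_hasCM)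
    (h0 : burungaleTian_analyticRank_eq_zero_of_selmerCorank_eq_zero_of_hasCM)
    (hE : hasEntireLFunction_rat)
    (W : WeierstrassCurve ℚ) [W.IsElliptic] [W.IsGloballyMinimal] (hCM : W.HasCM)
    (p : ℕ) [Fact p.Prime] (hp : 5 ≤ p) (hgood : W.HasGoodReductionAtPrime p)
    (hord : ¬ (p : ℤ) ∣ W.frobeniusTrace p)
    (K : Type) [Field K] [NumberField K] (h2 : Module.finrank ℚ K = 2)
    (hsplit : SatisfiesHeegnerHypothesis p K) (h : (W.baseChange K).selmerCorank p = 1) :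
    analyticRankEK W K = 1 :=
  analyticRankEK_eq_one_of_hasCM_of_selmerCorank_baseChange_eq_one_of_burungaleTian h1 h0 hE W hCM
    p hp hgood hord K h2
    (Literature.SatisfiesHeegnerHypothesis.not_dvd_discr h2 hsplit (Fact.out : p.Prime) dvd_rfl) h

/-- **The `K`-level leaf of route B, restricted to CM curves, from Burungale–Tian's two facts.**
The display of Burungale–Castella–Grossi–Skinner's Cor. 1 (rank-one case) in the Lean rendering
`hBCGS` of `BSDSelmerPConverseYanZhuProofs` / `BSDSelmerCMPConverseHeegnerFieldProofs` — `p > 3`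
good ordinary, (irr), `K` imaginary quadratic with (Heeg) for `N = W.conductorNorm ℤ`, (disc)
`d_K` odd `≠ -3`, (tor), `p` split, corank one over `K` ⟹ `analyticRankEK W K = 1` — with the
extra hypothesis `W.HasCM`, follows from the two `ℚ`-level facts and modularity
(`analyticRankEK_eq_one_of_hasCM_of_selmerCorank_baseChange_eq_one_of_split_of_burungaleTian`;
`3 < p ∧ p ≠ 4` is `5 ≤ p` for a prime). The hypotheses (irr), (Heeg), (disc) and (tor) are not
used. [cite: BurungaleTian2019, Thm. 1.2 (p. 214)] [cite: BurungaleTian2026, Thm. 1.1]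
[cite: BurungaleEtAl2026, Cor. 1 (rank-one case; arXiv:2312.09301, §0.1, p. 4)] -/
theorem bcgsLeaf_of_hasCM_of_burungaleTian
    (h1 : burungaleTian_analyticRank_eq_one_of_selmerCorank_eq_one_of_hasCM)
    (h0 : burungaleTian_analyticRank_eq_zero_of_selmerCorank_eq_zero_of_hasCM)
    (hE : hasEntireLFunction_rat) :
    ∀ (W : WeierstrassCurve ℚ) [W.IsElliptic] [W.IsGloballyMinimal], W.HasCM →
      ∀ (p : ℕ) [Fact p.Prime],
      3 < p → W.HasGoodReductionAtPrime p → ¬ (p : ℤ) ∣ W.frobeniusTrace p →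
      W.HasIrreducibleModPGaloisRep p →
      ∀ (K : Type) [Field K] [NumberField K], IsImaginaryQuadratic K →
        SatisfiesHeegnerHypothesis (W.conductorNorm ℤ) K →
        Odd (NumberField.discr K) → NumberField.discr K ≠ -3 →
        AddSubgroup.torsionBy (W.baseChange K).toAffine.Point (p : ℤ) = ⊥ →
        SatisfiesHeegnerHypothesis p K →
        (W.baseChange K).selmerCorank p = 1 → analyticRankEK W K = 1 := by
  intro W _ _ hCM p _ hp3 hgood hord _ K _ _ hK _ _ _ _ hsplit h
  have hpP : p.Prime := Fact.out
  have hp5 : 5 ≤ p := by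
    rcases hpP.eq_two_or_odd' with h2 | hoddp
    · omega
    · obtain ⟨k, hk⟩ := hoddp
      by_contra hlt
      have h4 : p = 4 := by omega
      omega
  exact analyticRankEK_eq_one_of_hasCM_of_selmerCorank_baseChange_eq_one_of_split_of_burungaleTian
    h1 h0 hE W hCM p hp5 hgood hord K hK.1 hsplit h

/-- **BCGS Cor. 1 need only be vendored for non-CM curves.** The full inline leaf `hBCGS` of the
bsd.S25 cluster (Burungale–Castella–Grossi–Skinner, Cor. 1, rank-one case, for EVERY `E/ℚ`)
follows from its restriction to curves WITHOUT complex multiplication (`hnonCM`) together with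
Burungale–Tian's two `p`-converse theorems for CM curves (`h1`, `h0`) and modularity (`hE`), by
`bcgsLeaf_of_hasCM_of_burungaleTian` and excluded middle on `W.HasCM`.
[cite: BurungaleEtAl2026, Cor. 1 (rank-one case; arXiv:2312.09301, §0.1, p. 4)]
[cite: BurungaleTian2019, Thm. 1.2 (p. 214)] [cite: BurungaleTian2026, Thm. 1.1] -/
theorem bcgsLeaf_of_not_hasCM_of_burungaleTian
    (h1 : burungaleTian_analyticRank_eq_one_of_selmerCorank_eq_one_of_hasCM)
    (h0 : burungaleTian_analyticRank_eq_zero_of_selmerCorank_eq_zero_of_hasCM)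
    (hE : hasEntireLFunction_rat)
    (hnonCM : ∀ (W : WeierstrassCurve ℚ) [W.IsElliptic] [W.IsGloballyMinimal], ¬ W.HasCM →
      ∀ (p : ℕ) [Fact p.Prime],
      3 < p → W.HasGoodReductionAtPrime p → ¬ (p : ℤ) ∣ W.frobeniusTrace p →
      W.HasIrreducibleModPGaloisRep p →
      ∀ (K : Type) [Field K] [NumberField K], IsImaginaryQuadratic K →
        SatisfiesHeegnerHypothesis (W.conductorNorm ℤ) K →
        Odd (NumberField.discr K) → NumberField.discr K ≠ -3 →
        AddSubgroup.torsionBy (W.baseChange K).toAffine.Point (p : ℤ) = ⊥ →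
        SatisfiesHeegnerHypothesis p K →
        (W.baseChange K).selmerCorank p = 1 → analyticRankEK W K = 1) :
    ∀ (W : WeierstrassCurve ℚ) [W.IsElliptic] [W.IsGloballyMinimal] (p : ℕ) [Fact p.Prime],
      3 < p → W.HasGoodReductionAtPrime p → ¬ (p : ℤ) ∣ W.frobeniusTrace p →
      W.HasIrreducibleModPGaloisRep p →
      ∀ (K : Type) [Field K] [NumberField K], IsImaginaryQuadratic K →
        SatisfiesHeegnerHypothesis (W.conductorNorm ℤ) K →
        Odd (NumberField.discr K) → NumberField.discr K ≠ -3 →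
        AddSubgroup.torsionBy (W.baseChange K).toAffine.Point (p : ℤ) = ⊥ →
        SatisfiesHeegnerHypothesis p K →
        (W.baseChange K).selmerCorank p = 1 → analyticRankEK W K = 1 := by
  intro W _ _ p _ hp3 hgood hord hirr K _ _ hK hH hodd hne3 htor hsplit h
  by_cases hCM : W.HasCM
  · exact bcgsLeaf_of_hasCM_of_burungaleTian h1 h0 hE W hCM p hp3 hgood hord hirr K hK hH hodd
      hne3 htor hsplit h
  · exact hnonCM W hCM p hp3 hgood hord hirr K hK hH hodd hne3 htor hsplit h

end KLevel

/-! ## Part 3. Route B with the leaf restricted to CM curves -/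

section RouteBCM

/-- **Route B from the sign onwards, with the `K`-level leaf restricted to CM curves.** The proof
of `analyticRank_eq_one_of_hasCM_of_bcgs_of_rootNumber_eq_neg_one` applies the inline leaf `hBCGS`
only to the CM curve `W` itself, so the CM-restricted display `hBCGS_CM` (same rendering, one more
hypothesis `W.HasCM`) suffices: Hoffstein–Luo field `K` with every `ℓ ∣ N_E` split, `p` split,
`d_K ≡ 1 (mod 8)` and `L(E^{(d_K)}, 1) ≠ 0` (`hmod`, `hHL`); Kato for the twist (`hKato`);
`corank Sel_{p^∞}(E/K) = 1 + 0` (`selmerCorank_baseChange_quadratic_holds`); (irr) by Serre for CM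
curves and (tor) from it (`torsionBy_eq_bot_of_hasIrreducibleModPGaloisRep`); the leaf; and
`ord L(E/K) = ord L(E) + 0`. [cite: BurungaleTian2019, Thm. 1.2 (p. 214)]
[cite: BurungaleEtAl2026, Thm. 1 and Cor. 1 (arXiv:2312.09301, §0.1, pp. 3–4)]
[cite: HoffsteinLuo1997, Theorem (§1, pp. 435–436)] [cite: Kato2004Asterisque, Cor. 14.3 (p. 235)] -/
theorem analyticRank_eq_one_of_hasCM_of_bcgsCM_of_rootNumber_eq_neg_one
    (hmod : ModularForms.exists_isNewformOf) (hHL : HoffsteinLuo1997_exists_twist_L_one_ne_zero)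
    (hKato : ∀ (W : WeierstrassCurve ℚ) [W.IsElliptic] (p : ℕ) [Fact p.Prime],
      kato_finite_of_L_one_ne_zero W p)
    (hBCGS_CM : ∀ (W : WeierstrassCurve ℚ) [W.IsElliptic] [W.IsGloballyMinimal], W.HasCM →
      ∀ (p : ℕ) [Fact p.Prime],
      3 < p → W.HasGoodReductionAtPrime p → ¬ (p : ℤ) ∣ W.frobeniusTrace p →
      W.HasIrreducibleModPGaloisRep p →
      ∀ (K : Type) [Field K] [NumberField K], IsImaginaryQuadratic K →
        SatisfiesHeegnerHypothesis (W.conductorNorm ℤ) K →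
        Odd (NumberField.discr K) → NumberField.discr K ≠ -3 →
        AddSubgroup.torsionBy (W.baseChange K).toAffine.Point (p : ℤ) = ⊥ →
        SatisfiesHeegnerHypothesis p K →
        (W.baseChange K).selmerCorank p = 1 → analyticRankEK W K = 1)
    (W : WeierstrassCurve ℚ) [W.IsElliptic] [W.IsGloballyMinimal] (hCM : W.HasCM) (p : ℕ)
    [Fact p.Prime] (hp : 5 ≤ p) (hgood : W.HasGoodReductionAtPrime p)
    (hord : ¬ (p : ℤ) ∣ W.frobeniusTrace p) (hw : W.rootNumber = -1)
    (hcorank : W.selmerCorank p = 1) : W.analyticRank = 1 := by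
  have hpP : p.Prime := Fact.out
  -- (b) the auxiliary imaginary quadratic field, from Hoffstein–Luo, with `d_K ≡ 1 (mod 8)`
  obtain ⟨K, _, _, hK, -, hHN, hHp, hd8, hL1⟩ :=
    exists_heegnerField_split_twist_ne_zero_discr_emod_eight_of_hoffsteinLuo hmod hHL W hw hpP 0
  -- (disc): `d_K` odd and `d_K ≠ -3`
  have hodd : Odd (NumberField.discr K) := Int.odd_iff.mpr (by omega)
  have hne3 : NumberField.discr K ≠ -3 := by omega
  -- (c) Kato: the `p^∞`-Selmer group of the twist is finite, hence of corank `0`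
  have hd : (NumberField.discr K : ℚ) ≠ 0 := by exact_mod_cast NumberField.discr_ne_zero K
  haveI := W.isElliptic_quadraticTwist hd
  obtain ⟨-, -, hfin⟩ := hKato (W.quadraticTwist (NumberField.discr K : ℚ)) p hL1
  haveI := hfin
  have h0 : (W.quadraticTwist (NumberField.discr K : ℚ)).selmerCorank p = 0 :=
    (W.quadraticTwist (NumberField.discr K : ℚ)).selmerCorank_eq_zero_of_finite p
  -- (d) the corank over `K` is `1 + 0 = 1`
  have hK1 : (W.baseChange K).selmerCorank p = 1 := by
    rw [selmerCorank_baseChange_quadratic_holds W K hK.1 p, hcorank, h0]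
  -- (irr) by Serre for CM curves, (tor) from it
  have hirr : W.HasIrreducibleModPGaloisRep p :=
    W.hasIrreducibleModPGaloisRep_of_hasCM_of_five_le hCM p hp hgood hord
  have htor : AddSubgroup.torsionBy (W.baseChange K).toAffine.Point (p : ℤ) = ⊥ :=
    torsionBy_eq_bot_of_hasIrreducibleModPGaloisRep W K hK.1 hpP hirr
  -- (e'') the CM-restricted leaf over this `K`
  have hEK : analyticRankEK W K = 1 :=
    hBCGS_CM W hCM p (by omega) hgood hord hirr K hK hHN hodd hne3 htor hHp hK1
  -- (f) factorisation of the analytic rank over `K`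
  rw [analyticRankEK_eq_add_of (hasEntireLFunction_rat_of_exists_isNewformOf hmod) W K,
    analyticRank_eq_zero_of_entireLFunction_one_ne_zero _ hL1, add_zero] at hEK
  exact hEK

/-- **Burungale–Tian's Thm. 1.2 along route B with the CM-restricted leaf**: the named fact from
the `p`-parity theorem (`hpar`: corank `1` gives `w(E) = -1`), the Modularity Theorem (`hmod`),
Hoffstein–Luo (`hHL`), Kato (`hKato`) and the `K`-level leaf FOR CM CURVES ONLY (`hBCGS_CM`), by
`analyticRank_eq_one_of_hasCM_of_bcgsCM_of_rootNumber_eq_neg_one`.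
[cite: BurungaleTian2019, Thm. 1.2 (p. 214)]
[cite: BurungaleEtAl2026, Thm. 1 and Cor. 1 (arXiv:2312.09301, §0.1, pp. 3–4)]
[cite: DokchitserDokchitserAnnals2010, Thm. 1.4] -/
theorem burungaleTian_analyticRank_eq_one_of_selmerCorank_eq_one_of_hasCM_of_bcgsCM
    (hpar : ∀ (W : WeierstrassCurve ℚ) [W.IsElliptic] (p : ℕ) [Fact p.Prime], p_parity W p)
    (hmod : ModularForms.exists_isNewformOf) (hHL : HoffsteinLuo1997_exists_twist_L_one_ne_zero)
    (hKato : ∀ (W : WeierstrassCurve ℚ) [W.IsElliptic] (p : ℕ) [Fact p.Prime],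
      kato_finite_of_L_one_ne_zero W p)
    (hBCGS_CM : ∀ (W : WeierstrassCurve ℚ) [W.IsElliptic] [W.IsGloballyMinimal], W.HasCM →
      ∀ (p : ℕ) [Fact p.Prime],
      3 < p → W.HasGoodReductionAtPrime p → ¬ (p : ℤ) ∣ W.frobeniusTrace p →
      W.HasIrreducibleModPGaloisRep p →
      ∀ (K : Type) [Field K] [NumberField K], IsImaginaryQuadratic K →
        SatisfiesHeegnerHypothesis (W.conductorNorm ℤ) K →
        Odd (NumberField.discr K) → NumberField.discr K ≠ -3 →
        AddSubgroup.torsionBy (W.baseChange K).toAffine.Point (p : ℤ) = ⊥ →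
        SatisfiesHeegnerHypothesis p K →
        (W.baseChange K).selmerCorank p = 1 → analyticRankEK W K = 1) :
    burungaleTian_analyticRank_eq_one_of_selmerCorank_eq_one_of_hasCM := by
  intro W _ _ hCM p _ hp hgood hord hcorank
  -- (a) parity: the root number is `-1`
  have hw : W.rootNumber = -1 := by
    have h := hpar W p
    unfold p_parity at h
    rw [hcorank, pow_one] at h
    exact h.symm
  exact analyticRank_eq_one_of_hasCM_of_bcgsCM_of_rootNumber_eq_neg_one hmod hHL hKato hBCGS_CM W
    hCM p hp hgood hord hw hcorank

end RouteBCM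

/-! ## Part 4. The equivalence: over CM curves the `K`-level leaf is the fact itself -/

section Equivalence

/-- **Burungale–Tian's Thm. 1.2 ⟺ the CM-restricted `K`-level leaf, modulo the common leaves of
the cluster.** Granted Burungale–Tian's rank-zero `p`-converse (`h0`), the `p`-parity theorem
(`hpar`), the Modularity Theorem (`hmod`), Hoffstein–Luo (`hHL`) and Kato (`hKato`) — all named
facts of the tree — the rank-one fact `burungaleTian_analyticRank_eq_one_of_selmerCorank_eq_one_of_hasCM`
is EQUIVALENT to the display of Burungale–Castella–Grossi–Skinner's Cor. 1 (rank-one case) for CM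
curves: "⟸" is route B (`burungaleTian_analyticRank_eq_one_of_selmerCorank_eq_one_of_hasCM_of_bcgsCM`),
"⟹" is `bcgsLeaf_of_hasCM_of_burungaleTian` (which uses only `h0` and modularity). Consequently a
named fact "BCGS Cor. 1 for CM curves" would be debt-equivalent to the fact itself: the `K`-level
and the `ℚ`-level corank-one `p`-converses for CM curves are one theorem up to the rank-zero
`p`-converse and the classical inputs. [cite: BurungaleTian2019, Thm. 1.2 (p. 214)]
[cite: BurungaleTian2026, Thm. 1.1]
[cite: BurungaleEtAl2026, Cor. 1 (rank-one case; arXiv:2312.09301, §0.1, p. 4)] -/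
theorem burungaleTian_analyticRank_eq_one_iff_bcgsCM_of_facts
    (h0 : burungaleTian_analyticRank_eq_zero_of_selmerCorank_eq_zero_of_hasCM)
    (hpar : ∀ (W : WeierstrassCurve ℚ) [W.IsElliptic] (p : ℕ) [Fact p.Prime], p_parity W p)
    (hmod : ModularForms.exists_isNewformOf) (hHL : HoffsteinLuo1997_exists_twist_L_one_ne_zero)
    (hKato : ∀ (W : WeierstrassCurve ℚ) [W.IsElliptic] (p : ℕ) [Fact p.Prime],
      kato_finite_of_L_one_ne_zero W p) :
    burungaleTian_analyticRank_eq_one_of_selmerCorank_eq_one_of_hasCM ↔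
      ∀ (W : WeierstrassCurve ℚ) [W.IsElliptic] [W.IsGloballyMinimal], W.HasCM →
        ∀ (p : ℕ) [Fact p.Prime],
        3 < p → W.HasGoodReductionAtPrime p → ¬ (p : ℤ) ∣ W.frobeniusTrace p →
        W.HasIrreducibleModPGaloisRep p →
        ∀ (K : Type) [Field K] [NumberField K], IsImaginaryQuadratic K →
          SatisfiesHeegnerHypothesis (W.conductorNorm ℤ) K →
          Odd (NumberField.discr K) → NumberField.discr K ≠ -3 →
          AddSubgroup.torsionBy (W.baseChange K).toAffine.Point (p : ℤ) = ⊥ →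
          SatisfiesHeegnerHypothesis p K →
          (W.baseChange K).selmerCorank p = 1 → analyticRankEK W K = 1 :=
  ⟨fun h1 ↦ bcgsLeaf_of_hasCM_of_burungaleTian h1 h0
      (hasEntireLFunction_rat_of_exists_isNewformOf hmod),
    fun h ↦ burungaleTian_analyticRank_eq_one_of_selmerCorank_eq_one_of_hasCM_of_bcgsCM hpar hmod
      hHL hKato h⟩

end Equivalence

/-! ## Part 5. At a good ordinary `p > 3` a CM curve has non-surjective mod-`p` image; so the
## non-CM half of the leaf already carries Yan–Zhu's corollary -/

section NonSurjective

open scoped MatrixGroups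

/-- **Serre 1972, §4.5 at a good ordinary prime, effectively: for `E/ℚ` with complex
multiplication and a prime `p > 3` of good ordinary reduction, `ρ̄_{E,p} : Γ_ℚ → Aut(E[p])` is
NOT surjective.** (The tree's `exists_bound_forall_not_hasSurjectiveModNGaloisRep_of_hasCM` gives
this beyond an inexplicit bound `L₀`; here the ordinary hypothesis replaces the bound.) Proof: the
twisted square root `φ` of `D` visible on `E[p]` (`exists_sqrt_twist_apply_ne_zero_of_hasCM`,
`exists_restrict_geomTorsion_of_twist`: `φ² = D`, `φ(σP) = χ(σ) σ φ(P)`, `χ ≠ 1`, `φ ≠ 0`) has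
`p ∤ D` at a good ordinary `p > 3` (`not_dvd_of_sqrt_twist_of_not_dvd_frobeniusTrace`, Deuring:
ramified primes are supersingular), hence is a non-scalar (`geomTorsion_ne_smul_of_twist`) square
root of a unit, and every `ρ̄(σ)` commutes or anti-commutes with its matrix `Φ`
(`exists_matrix_sqrt_frame`): the image lies in the normaliser of the Cartan subgroup `𝔽_p[Φ]ˣ`.
The transvection `(1 1; 0 1)` does neither (`transvection_not_comm_not_anticomm`, `p` odd), so it
is not in the image. [cite: Serre1972, §4.5 (with §2.2 and §1.11)]
[cite: Lang1987, Ch. 10 §4, Remark and Thm. 8] -/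
theorem not_hasSurjectiveModNGaloisRep_of_hasCM_of_not_dvd_frobeniusTrace (W : WeierstrassCurve ℚ)
    [W.IsElliptic] [W.IsGloballyMinimal] (hCM : W.HasCM) (p : ℕ) [Fact p.Prime] (hp3 : 3 < p)
    (hgood : W.HasGoodReductionAtPrime p) (hord : ¬ (p : ℤ) ∣ W.frobeniusTrace p) :
    ¬ W.HasSurjectiveModNGaloisRep p := by
  intro hsurj
  have hp : p.Prime := Fact.out
  haveI : NeZero p := ⟨hp.ne_zero⟩
  have hp2 : p ≠ 2 := by omega
  have hΔ := W.not_dvd_minimalDiscriminantInt_of_hasGoodReductionAtPrime' p hgood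
  -- a twisted `√D` visible on `E[p]`
  obtain ⟨ψ, D, χ, -, hψψ, hχ, hrel, P₀, hP₀p, hP₀⟩ :=
    W.exists_sqrt_twist_apply_ne_zero_of_hasCM hCM hp
  have hψψ' : ψ * ψ = (D : AddMonoid.End W.geomPoints) := by
    refine AddMonoidHom.ext fun P ↦ ?_
    change ψ (ψ P) = (D : AddMonoid.End W.geomPoints) P
    rw [AddMonoid.End.intCast_apply]
    exact hψψ P
  obtain ⟨φ, hφcoe, hφφ, hφrel⟩ := exists_restrict_geomTorsion_of_twist W hψψ' hrel p
  have hP₀mem : P₀ ∈ W.geomTorsion p := by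
    rwa [Submodule.mem_toAddSubgroup, Submodule.mem_torsionBy_iff]
  have hφ0 : ∃ P : W.geomTorsion p, φ P ≠ 0 :=
    ⟨⟨P₀, hP₀mem⟩, fun h ↦ hP₀ (by rw [← hφcoe ⟨P₀, hP₀mem⟩, h]; rfl)⟩
  -- `p ∤ D` (good ordinary, `p > 3`)
  have hpD := W.not_dvd_of_sqrt_twist_of_not_dvd_frobeniusTrace p hp3 hΔ hord hφφ hφrel hφ0
  -- `φ` is no scalar
  obtain ⟨σ₀, hσ₀⟩ := hχ
  have hσ₀' : χ σ₀ = -1 := (Int.units_eq_one_or _).resolve_left hσ₀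
  have hanti : ∀ P : W.geomTorsion p, φ (σ₀ • P) = -(σ₀ • φ P) := fun P ↦ by
    rw [hφrel, hσ₀', Units.val_neg, Units.val_one, neg_one_zsmul]
  have hnsZ : ∀ c : ℤ, ∃ P : W.geomTorsion p, φ P ≠ c • P := fun c ↦
    W.geomTorsion_ne_smul_of_twist hp hp2 hpD φ hφφ hanti c
  -- frame, matrix of `φ`, and the dichotomy "commute or anti-commute"
  obtain ⟨e, Φfr, he, -, -, -, -⟩ := exists_frame_galoisRepTorsion_rat W p
  obtain ⟨Φ, -, hΦsq, hΦns, hdich⟩ := exists_matrix_sqrt_frame W p e Φfr he hφφ hnsZ hφrel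
  have h2 : (2 : ZMod p) ≠ 0 := by
    intro h0
    have : p ∣ 2 := (ZMod.natCast_eq_zero_iff 2 p).mp (by exact_mod_cast h0)
    exact absurd (Nat.le_of_dvd two_pos this) (by omega)
  have hD' : ((D : ℤ) : ZMod p) ≠ 0 := by
    rwa [Ne, ZMod.intCast_zmod_eq_zero_iff_dvd]
  obtain ⟨hc, ha⟩ := transvection_not_comm_not_anticomm h2 hΦsq hD' hΦns
  -- the transvection lies in the (full) image
  have hdetT : Matrix.det !![(1 : ZMod p), 1; 0, 1] ≠ 0 := by
    simp [Matrix.det_fin_two]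
  set T : GL (Fin 2) (ZMod p) := Matrix.GeneralLinearGroup.mkOfDetNeZero _ hdetT with hT
  have hTmem : T ∈ (galoisRepTorsion W p).range.map Φfr.toMonoidHom := by
    rw [(map_range_galoisRepTorsion_eq_top_iff W p Φfr).mpr hsurj]
    exact Subgroup.mem_top T
  obtain ⟨σ, hσ⟩ := (mem_map_range_galoisRepTorsion_iff W p Φfr).mp hTmem
  have hTval : ((Φfr (galoisRepTorsion W p σ) : GL (Fin 2) (ZMod p)) :
      Matrix (Fin 2) (Fin 2) (ZMod p)) = !![(1 : ZMod p), 1; 0, 1] := by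
    rw [hσ, hT]
    rfl
  rcases hdich σ with ⟨h, -⟩ | ⟨h, -⟩
  · exact hc (by rwa [hTval] at h)
  · exact ha (by rwa [hTval] at h)

/-- **The same at `p ≥ 5`** (the form of the `p`-converse theorems). In particular a curve with
surjective `ρ̄_{E,p}` at a good ordinary `p ≥ 5` — the setting of Yan–Zhu's Cor. 1.4 and of
Burungale–Skinner–Tian–Wan's Thm. 1.10 — has no complex multiplication.
[cite: Serre1972, §4.5] -/
theorem not_hasCM_of_hasSurjectiveModNGaloisRep_of_five_le (W : WeierstrassCurve ℚ)
    [W.IsElliptic] [W.IsGloballyMinimal] (p : ℕ) [Fact p.Prime] (hp : 5 ≤ p)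
    (hgood : W.HasGoodReductionAtPrime p) (hord : ¬ (p : ℤ) ∣ W.frobeniusTrace p)
    (hsurj : W.HasSurjectiveModNGaloisRep p) : ¬ W.HasCM := fun hCM ↦
  not_hasSurjectiveModNGaloisRep_of_hasCM_of_not_dvd_frobeniusTrace W hCM p (by omega) hgood hord
    hsurj

/-- **Yan–Zhu's Cor. 1.4 from the NON-CM half of the leaf.** The pointwise route of
`yanZhu_analyticRank_eq_one_of_selmerCorank_eq_one_of_bcgs_of_rootNumber_eq_neg_one` — Hoffstein–
Luo field, Kato for the twist, corank `1 + 0` over `K`, (irr) and (tor) from surjectivity, the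
`K`-level leaf, `ord L(E/K) = ord L(E) + 0` — run with the leaf restricted to curves WITHOUT
complex multiplication (`hnonCM`), which is all it is ever applied to: the curve in hand has
surjective `ρ̄_{E,p}` at the good ordinary `p > 3`, hence no CM
(`not_hasSurjectiveModNGaloisRep_of_hasCM_of_not_dvd_frobeniusTrace`).
[cite: YanZhu2024MainConjNonCM, Thm. 4.15 (proof, §4.6)]
[cite: BurungaleEtAl2026, Thm. 1 and Cor. 1 (arXiv:2312.09301, §0.1, pp. 3–4)]
[cite: HoffsteinLuo1997, Theorem (§1, pp. 435–436)] [cite: Kato2004Asterisque, Cor. 14.3 (p. 235)] -/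
theorem yanZhu_analyticRank_eq_one_of_selmerCorank_eq_one_of_bcgsNonCM_of_rootNumber_eq_neg_one
    (hmod : ModularForms.exists_isNewformOf) (hHL : HoffsteinLuo1997_exists_twist_L_one_ne_zero)
    (hKato : ∀ (W : WeierstrassCurve ℚ) [W.IsElliptic] (p : ℕ) [Fact p.Prime],
      kato_finite_of_L_one_ne_zero W p)
    (hnonCM : ∀ (W : WeierstrassCurve ℚ) [W.IsElliptic] [W.IsGloballyMinimal], ¬ W.HasCM →
      ∀ (p : ℕ) [Fact p.Prime],
      3 < p → W.HasGoodReductionAtPrime p → ¬ (p : ℤ) ∣ W.frobeniusTrace p →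
      W.HasIrreducibleModPGaloisRep p →
      ∀ (K : Type) [Field K] [NumberField K], IsImaginaryQuadratic K →
        SatisfiesHeegnerHypothesis (W.conductorNorm ℤ) K →
        Odd (NumberField.discr K) → NumberField.discr K ≠ -3 →
        AddSubgroup.torsionBy (W.baseChange K).toAffine.Point (p : ℤ) = ⊥ →
        SatisfiesHeegnerHypothesis p K →
        (W.baseChange K).selmerCorank p = 1 → analyticRankEK W K = 1)
    (W : WeierstrassCurve ℚ) [W.IsElliptic] [W.IsGloballyMinimal] (p : ℕ) [Fact p.Prime]
    (hp : 3 < p) (hgood : W.HasGoodReductionAtPrime p) (hord : ¬ (p : ℤ) ∣ W.frobeniusTrace p)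
    (hsurj : W.HasSurjectiveModNGaloisRep p) (hw : W.rootNumber = -1)
    (hcorank : W.selmerCorank p = 1) : W.analyticRank = 1 := by
  have hpP : p.Prime := Fact.out
  have hnCM : ¬ W.HasCM := fun hCM ↦
    not_hasSurjectiveModNGaloisRep_of_hasCM_of_not_dvd_frobeniusTrace W hCM p hp hgood hord hsurj
  -- (b) the auxiliary imaginary quadratic field, from Hoffstein–Luo, with `d_K ≡ 1 (mod 8)`
  obtain ⟨K, _, _, hK, -, hHN, hHp, hd8, hL1⟩ :=
    exists_heegnerField_split_twist_ne_zero_discr_emod_eight_of_hoffsteinLuo hmod hHL W hw hpP 0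
  -- (disc): `d_K` odd and `d_K ≠ -3`
  have hodd : Odd (NumberField.discr K) := Int.odd_iff.mpr (by omega)
  have hne3 : NumberField.discr K ≠ -3 := by omega
  -- (c) Kato: the `p^∞`-Selmer group of the twist is finite, hence of corank `0`
  have hd : (NumberField.discr K : ℚ) ≠ 0 := by exact_mod_cast NumberField.discr_ne_zero K
  haveI := W.isElliptic_quadraticTwist hd
  obtain ⟨-, -, hfin⟩ := hKato (W.quadraticTwist (NumberField.discr K : ℚ)) p hL1
  haveI := hfin
  have h0 : (W.quadraticTwist (NumberField.discr K : ℚ)).selmerCorank p = 0 :=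
    (W.quadraticTwist (NumberField.discr K : ℚ)).selmerCorank_eq_zero_of_finite p
  -- (d) the corank over `K` is `1 + 0 = 1`
  have hK1 : (W.baseChange K).selmerCorank p = 1 := by
    rw [selmerCorank_baseChange_quadratic_holds W K hK.1 p, hcorank, h0]
  -- (irr) and (tor) from the surjectivity of `ρ̄_{E,p}`
  haveI : NeZero (p : ℚ) := ⟨by exact_mod_cast hpP.ne_zero⟩
  have hirr : W.HasIrreducibleModPGaloisRep p :=
    hasIrreducibleModPGaloisRep_of_hasSurjectiveModNGaloisRep W p hsurj
  have htor : AddSubgroup.torsionBy (W.baseChange K).toAffine.Point (p : ℤ) = ⊥ :=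
    torsionBy_eq_bot_of_isImaginaryQuadratic W K hK hpP (by omega) hsurj
  -- (e'') the non-CM half of the leaf over this `K`
  have hEK : analyticRankEK W K = 1 :=
    hnonCM W hnCM p hp hgood hord hirr K hK hHN hodd hne3 htor hHp hK1
  -- (f) factorisation of the analytic rank over `K`
  rw [analyticRankEK_eq_add_of (hasEntireLFunction_rat_of_exists_isNewformOf hmod) W K,
    analyticRank_eq_zero_of_entireLFunction_one_ne_zero _ hL1, add_zero] at hEK
  exact hEK

/-- **Yan–Zhu's Cor. 1.4 (the tree's `yanZhu_analyticRank_eq_one_of_selmerCorank_eq_one`) from the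
`p`-parity theorem, Modularity, Hoffstein–Luo, Kato and the NON-CM half of BCGS's Cor. 1** — so,
with `bcgsLeaf_of_hasCM_of_burungaleTian`, the single inline leaf `hBCGS` of the bsd.S25 cluster
splits along CM / non-CM into a half equivalent to Burungale–Tian's CM theorems and a half that
alone carries the big-image corollaries. [cite: YanZhu2024MainConjNonCM, Cor. 1.4 and Thm. 4.15 (proof, §4.6)]
[cite: BurungaleEtAl2026, Thm. 1 and Cor. 1 (arXiv:2312.09301, §0.1, pp. 3–4)]
[cite: DokchitserDokchitserAnnals2010, Thm. 1.4] -/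
theorem yanZhu_analyticRank_eq_one_of_selmerCorank_eq_one_of_bcgsNonCM
    (hpar : ∀ (W : WeierstrassCurve ℚ) [W.IsElliptic] (p : ℕ) [Fact p.Prime], p_parity W p)
    (hmod : ModularForms.exists_isNewformOf) (hHL : HoffsteinLuo1997_exists_twist_L_one_ne_zero)
    (hKato : ∀ (W : WeierstrassCurve ℚ) [W.IsElliptic] (p : ℕ) [Fact p.Prime],
      kato_finite_of_L_one_ne_zero W p)
    (hnonCM : ∀ (W : WeierstrassCurve ℚ) [W.IsElliptic] [W.IsGloballyMinimal], ¬ W.HasCM →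
      ∀ (p : ℕ) [Fact p.Prime],
      3 < p → W.HasGoodReductionAtPrime p → ¬ (p : ℤ) ∣ W.frobeniusTrace p →
      W.HasIrreducibleModPGaloisRep p →
      ∀ (K : Type) [Field K] [NumberField K], IsImaginaryQuadratic K →
        SatisfiesHeegnerHypothesis (W.conductorNorm ℤ) K →
        Odd (NumberField.discr K) → NumberField.discr K ≠ -3 →
        AddSubgroup.torsionBy (W.baseChange K).toAffine.Point (p : ℤ) = ⊥ →
        SatisfiesHeegnerHypothesis p K →
        (W.baseChange K).selmerCorank p = 1 → analyticRankEK W K = 1) :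
    yanZhu_analyticRank_eq_one_of_selmerCorank_eq_one := by
  intro W _ _ p _ hp5 hgood hord hsurj hcorank
  -- (a) parity: the root number is `-1`
  have hw : W.rootNumber = -1 := by
    have h := hpar W p
    unfold p_parity at h
    rw [hcorank, pow_one] at h
    exact h.symm
  exact yanZhu_analyticRank_eq_one_of_selmerCorank_eq_one_of_bcgsNonCM_of_rootNumber_eq_neg_one hmod
    hHL hKato hnonCM W p (by omega) hgood hord hsurj hw hcorank

end NonSurjective

/-! ## Part 6. No element of `Γ_{ℚ(μ_p)}` fixes exactly a line of `E[p]` on a CM curve: the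
## transversality hypothesis (im) fails for CM curves -/

section NoFixedLine

open scoped MatrixGroups

open _root_.Matrix Literature.NumberTheory.GaloisRepresentations _root_.Field
open Literature.NumberTheory.GaloisRepresentations.DeligneSerre1974

/-- `det(M - 1) = 1 - tr M + det M` for a `2 × 2` matrix (the value at `1` of the characteristic
polynomial). [folklore] -/
theorem det_sub_one_fin_two {F : Type*} [Field F] (M : Matrix (Fin 2) (Fin 2) F) :
    (M - 1).det = 1 - M.trace + M.det := by
  have h := TwoByTwo.det_smul_one_add_smul (-1 : F) 1 M
  rw [one_smul, neg_smul, one_smul, neg_add_eq_sub] at h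
  rw [h]
  ring

/-- **An element of determinant `1` of the normaliser of a Cartan subgroup is the identity or has
no eigenvalue `1`.** Let `F` be a field with `2 ≠ 0`, `Φ ∈ M₂(F)` non-scalar with `Φ² = D ≠ 0`
(so `F[Φ]ˣ` is a Cartan subgroup, split or not according as `D` is a square), and `M ∈ M₂(F)`
with `det M = 1` commuting or anti-commuting with `Φ` (i.e. in the normaliser of `F[Φ]ˣ`, Serre
1972 §2.2). Then `M = 1` or `det(M - 1) ≠ 0`. Proof: if `ΦM = MΦ` then `M = a + bΦ`
(`TwoByTwo.exists_eq_smul_one_add_smul_of_commute`) with `a² - Db² = det M = 1` and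
`det(M - 1) = 1 - 2a + 1 = 2(1 - a)`, which vanishes only if `a = 1`, whence `Db² = 0`, `b = 0`,
`M = 1`; if `ΦM = -MΦ` then `D·tr M = tr(Φ²M) = tr(ΦMΦ) = -D·tr M`, so `tr M = 0` and
`det(M - 1) = 1 - 0 + 1 = 2 ≠ 0`. (Group-theoretically: in `N(C) ∩ SL₂`, the Cartan elements
`diag(a, a⁻¹)` have `coker(M - 1)` of dimension `0` or `2`, and the elements of the non-trivial
coset square to `-1`.) [cite: Serre1972, §2.2 (normalisers of Cartan subgroups)] -/
theorem eq_one_or_det_sub_one_ne_zero_of_cartanNormalizer {F : Type*} [Field F]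
    (h2 : (2 : F) ≠ 0) {Φ M : Matrix (Fin 2) (Fin 2) F} {D : F}
    (hΦ : Φ * Φ = D • (1 : Matrix (Fin 2) (Fin 2) F)) (hD : D ≠ 0) (hns : ∀ c : F, Φ ≠ c • 1)
    (hdich : Φ * M = M * Φ ∨ Φ * M = -(M * Φ)) (hdet : M.det = 1) :
    M = 1 ∨ (M - 1).det ≠ 0 := by
  obtain ⟨htrΦ, -⟩ := trace_eq_zero_and_det_eq_of_mul_self_eq_smul_one hΦ hns
  rcases hdich with hc | ha
  · -- commuting: `M = a + bΦ`
    obtain ⟨a, b, hab⟩ := TwoByTwo.exists_eq_smul_one_add_smul_of_commute hns hc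
    have hdet' : a ^ 2 - D * b ^ 2 = 1 := by
      rw [← det_smul_one_add_smul_eq_sq_sub hΦ hns a b, ← hab, hdet]
    have htrM : M.trace = 2 * a := by
      rw [hab, TwoByTwo.trace_smul_one_add_smul, htrΦ, mul_zero, add_zero]
    by_cases ha1 : a = 1
    · left
      subst ha1
      have hb : b = 0 := by
        have h0 : D * b ^ 2 = 0 := by linear_combination -hdet'
        rcases mul_eq_zero.mp h0 with h | h
        · exact absurd h hD
        · exact pow_eq_zero_iff (n := 2) (by norm_num) |>.mp h
      rw [hab, hb, zero_smul, add_zero, one_smul]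
    · right
      rw [det_sub_one_fin_two, htrM, hdet]
      intro h0
      apply ha1
      have h1 : (2 : F) * (1 - a) = 0 := by linear_combination h0
      rcases mul_eq_zero.mp h1 with h | h
      · exact absurd h h2
      · linear_combination -h
  · -- anti-commuting: `tr M = 0`, so `det(M - 1) = 2`
    right
    have htrM : M.trace = 0 := by
      have h1 : Φ * M * Φ = -(D • M) := by
        rw [ha, Matrix.neg_mul, Matrix.mul_assoc, hΦ, Matrix.mul_smul, Matrix.mul_one]
      have h2' : (Φ * M * Φ).trace = D * M.trace := by
        rw [Matrix.mul_assoc, Matrix.trace_mul_comm, Matrix.mul_assoc, hΦ, Matrix.mul_smul,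
          Matrix.mul_one, Matrix.trace_smul, smul_eq_mul]
      rw [h1, Matrix.trace_neg, Matrix.trace_smul, smul_eq_mul] at h2'
      have h3 : (2 : F) * (D * M.trace) = 0 := by linear_combination -h2'
      rcases mul_eq_zero.mp h3 with h | h
      · exact absurd h h2
      · rcases mul_eq_zero.mp h with h' | h'
        · exact absurd h' hD
        · exact h'
    rw [det_sub_one_fin_two, htrM, hdet]
    norm_num
    exact h2

/-- **On a CM curve at a good ordinary `p > 3`, an element of `Γ_{ℚ(μ_p)}` acts on `E[p]` either
trivially or without non-zero fixed points.** Let `E/ℚ` have complex multiplication (global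
minimal model `W`), `p > 3` a prime of good ordinary reduction, and `σ ∈ Γ_ℚ` with trivial mod-`p`
cyclotomic character (`σ ∈ Γ_{ℚ(μ_p)}`; so `det ρ̄_{E,p}(σ) = 1` by the Weil pairing,
`exists_frame_galoisRepTorsion_rat`). Then either `σ` fixes `E[p]` pointwise, or `σP = P` forces
`P = 0`. Proof: as in Part 5 the twisted square root `φ` of `D` on `E[p]` (`φ² = D`, `p ∤ D`,
`φ` non-scalar: `exists_sqrt_twist_apply_ne_zero_of_hasCM`, Deuring at the ordinary `p`) makes
every `ρ̄(σ)` commute or anti-commute with its matrix `Φ` (`exists_matrix_sqrt_frame`: the image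
normalises the Cartan subgroup `𝔽_p[Φ]ˣ`, Serre 1972 §4.5), and
`eq_one_or_det_sub_one_ne_zero_of_cartanNormalizer` applies to `M = ρ̄(σ)`, `det M = 1`:
`M = 1`, or `M - 1` is invertible so that `(M - 1)v = 0 ⟹ v = 0`.
[cite: Serre1972, §4.5 (with §2.2)] [cite: BurungaleCastellaSkinner2025, Rem. 1.1.3 and Rem. 1.2.3] -/
theorem smul_eq_self_or_eq_zero_of_hasCM_of_modPCyclotomicCharacterZMod_eq_one
    (W : WeierstrassCurve ℚ) [W.IsElliptic] [W.IsGloballyMinimal] (hCM : W.HasCM) (p : ℕ)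
    [Fact p.Prime] (hp3 : 3 < p) (hgood : W.HasGoodReductionAtPrime p)
    (hord : ¬ (p : ℤ) ∣ W.frobeniusTrace p) (σ : absoluteGaloisGroup ℚ)
    (hσ : modPCyclotomicCharacterZMod ℚ p σ = 1) :
    (∀ P : W.geomTorsion p, σ • P = P) ∨ (∀ P : W.geomTorsion p, σ • P = P → P = 0) := by
  have hp : p.Prime := Fact.out
  haveI : NeZero p := ⟨hp.ne_zero⟩
  have hp2 : p ≠ 2 := by omega
  have hΔ := W.not_dvd_minimalDiscriminantInt_of_hasGoodReductionAtPrime' p hgood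
  -- a twisted `√D` visible on `E[p]`
  obtain ⟨ψ, D, χ, -, hψψ, hχ, hrel, P₀, hP₀p, hP₀⟩ :=
    W.exists_sqrt_twist_apply_ne_zero_of_hasCM hCM hp
  have hψψ' : ψ * ψ = (D : AddMonoid.End W.geomPoints) := by
    refine AddMonoidHom.ext fun P ↦ ?_
    change ψ (ψ P) = (D : AddMonoid.End W.geomPoints) P
    rw [AddMonoid.End.intCast_apply]
    exact hψψ P
  obtain ⟨φ, hφcoe, hφφ, hφrel⟩ := exists_restrict_geomTorsion_of_twist W hψψ' hrel p
  have hP₀mem : P₀ ∈ W.geomTorsion p := by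
    rwa [Submodule.mem_toAddSubgroup, Submodule.mem_torsionBy_iff]
  have hφ0 : ∃ P : W.geomTorsion p, φ P ≠ 0 :=
    ⟨⟨P₀, hP₀mem⟩, fun h ↦ hP₀ (by rw [← hφcoe ⟨P₀, hP₀mem⟩, h]; rfl)⟩
  -- `p ∤ D` (good ordinary, `p > 3`)
  have hpD := W.not_dvd_of_sqrt_twist_of_not_dvd_frobeniusTrace p hp3 hΔ hord hφφ hφrel hφ0
  -- `φ` is no scalar
  obtain ⟨σ₀, hσ₀⟩ := hχ
  have hσ₀' : χ σ₀ = -1 := (Int.units_eq_one_or _).resolve_left hσ₀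
  have hanti : ∀ P : W.geomTorsion p, φ (σ₀ • P) = -(σ₀ • φ P) := fun P ↦ by
    rw [hφrel, hσ₀', Units.val_neg, Units.val_one, neg_one_zsmul]
  have hnsZ : ∀ c : ℤ, ∃ P : W.geomTorsion p, φ P ≠ c • P := fun c ↦
    W.geomTorsion_ne_smul_of_twist hp hp2 hpD φ hφφ hanti c
  -- frame (its determinant is the cyclotomic character), matrix of `φ`, and the dichotomy
  obtain ⟨e, Φfr, he, -, hdet, -, -⟩ := exists_frame_galoisRepTorsion_rat W p
  obtain ⟨Φ, -, hΦsq, hΦns, hdich⟩ := exists_matrix_sqrt_frame W p e Φfr he hφφ hnsZ hφrel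
  have h2 : (2 : ZMod p) ≠ 0 := by
    intro h0
    have : p ∣ 2 := (ZMod.natCast_eq_zero_iff 2 p).mp (by exact_mod_cast h0)
    exact absurd (Nat.le_of_dvd two_pos this) (by omega)
  have hD' : ((D : ℤ) : ZMod p) ≠ 0 := by
    rwa [Ne, ZMod.intCast_zmod_eq_zero_iff_dvd]
  set M : Matrix (Fin 2) (Fin 2) (ZMod p) :=
    ((Φfr (galoisRepTorsion W p σ) : GL (Fin 2) (ZMod p)) : Matrix (Fin 2) (Fin 2) (ZMod p))
    with hM
  have hdetM : M.det = 1 := by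
    have h := hdet σ
    rw [hσ] at h
    have h' := congrArg (fun u : (ZMod p)ˣ ↦ (u : ZMod p)) h
    simpa [Matrix.GeneralLinearGroup.val_det_apply] using h'
  have hdich' : Φ * M = M * Φ ∨ Φ * M = -(M * Φ) := by
    rcases hdich σ with ⟨h, -⟩ | ⟨h, -⟩
    · exact Or.inl h
    · exact Or.inr h
  -- the action through the frame: `e (σ • P) = M *ᵥ e P`
  have hact : ∀ P : W.geomTorsion p, e (σ • P) = M *ᵥ e P := fun P ↦ by
    rw [← galoisRepTorsion_apply, he]
  rcases eq_one_or_det_sub_one_ne_zero_of_cartanNormalizer h2 hΦsq hD' hΦns hdich' hdetM with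
    h1 | hne
  · left
    intro P
    apply e.injective
    rw [hact, h1, Matrix.one_mulVec]
  · right
    intro P hP
    have h0 : (M - 1) *ᵥ e P = 0 := by
      rw [Matrix.sub_mulVec, Matrix.one_mulVec, ← hact, hP, sub_self]
    have heP : e P = 0 := Matrix.eq_zero_of_mulVec_eq_zero hne h0
    exact e.injective (by rw [heP, map_zero])

/-- **Hence no element of `Γ_{ℚ(μ_p)}` fixes exactly a line of `E[p]`** (CM curve, good ordinary
`p > 3`): there is no `σ` with trivial mod-`p` cyclotomic character fixing a non-zero `p`-torsion
point without fixing all of `E[p]`. For an endomorphism `g` of the plane `E[p]`,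
`dim E[p]/(g - 1)E[p] = dim ker(g - 1)` (rank–nullity), so this says: the coinvariants of such a
`σ` on `E[p]` are never a line. In particular NO `σ ∈ Γ_{ℚ(μ_{p^∞})} ⊂ Γ_{ℚ(μ_p)}` has
`T_pE/(σ - 1)T_pE ≃ ℤ_p` — reducing modulo `p`, `E[p]/(σ̄ - 1)E[p]` would be a line — i.e. the
transversality hypothesis (im) "there exists `σ ∈ G_{ℚ(μ_{p^∞})}` such that `T/(σ - 1)T ≃ ℤ_p`"
of Burungale–Castella–Skinner, IMRN 2025, Thm. 1.1.2 (b) and Thm. 1.2.2 (b) (the integral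
equalities of characteristic ideals; Rem. 1.1.3 (i): "For non-CM curves the condition (im) holds
for all sufficiently large primes `p` by Serre's open image theorem"; Rem. 1.2.3: part (b)
excludes "(residually) dihedral primes"), which is Mazur–Rubin's hypothesis on `τ` for Kolyvagin
systems over `ℚ` (used for Kato's Kolyvagin system in Burungale–Castella–Grossi–Skinner's Thm. 3,
printed "without CM": "there exists `τ ∈ G_ℚ` such that `V_pE/(τ - 1)V_pE ≃ ℚ_p` since it
follows by Serre's open image theorem", arXiv:2312.09301 p. 23), fails for EVERY CM curve at
EVERY good ordinary `p > 3`. Together with Part 5 (non-surjectivity): of the anticyclotomic /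
cyclotomic main conjectures of that paper only the rational parts (a), printed under (irr_ℚ)
alone, can be fed a CM curve — consistent with route B resting on Thm. 1.2.2 (a).
[cite: BurungaleCastellaSkinner2025, Thm. 1.1.2 (b), Rem. 1.1.3 (i), (iii), Thm. 1.2.2 (b), Rem. 1.2.3]
[cite: BurungaleEtAl2026, Thm. 3 (arXiv:2312.09301, §0.1 p. 4) and its proof (p. 23)]
[cite: MazurRubin2004, §3.5] [cite: Serre1972, §4.5] -/
theorem not_exists_fixed_ne_zero_and_smul_ne_of_hasCM (W : WeierstrassCurve ℚ) [W.IsElliptic]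
    [W.IsGloballyMinimal] (hCM : W.HasCM) (p : ℕ) [Fact p.Prime] (hp3 : 3 < p)
    (hgood : W.HasGoodReductionAtPrime p) (hord : ¬ (p : ℤ) ∣ W.frobeniusTrace p) :
    ¬ ∃ σ : absoluteGaloisGroup ℚ, modPCyclotomicCharacterZMod ℚ p σ = 1 ∧
      (∃ P : W.geomTorsion p, P ≠ 0 ∧ σ • P = P) ∧ ∃ Q : W.geomTorsion p, σ • Q ≠ Q := by
  rintro ⟨σ, hσ, ⟨P, hP0, hP⟩, Q, hQ⟩
  rcases smul_eq_self_or_eq_zero_of_hasCM_of_modPCyclotomicCharacterZMod_eq_one W hCM p hp3 hgood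
      hord σ hσ with h | h
  · exact hQ (h Q)
  · exact hP0 (h P hP)

end NoFixedLine

/-! ## Part 7. Route B for CM curves on the classical CM inputs: Coates–Wiles and Rubin (1987) in
place of Kato, and parity only on the fact's own domain

In Part 3 the rank-zero input at the auxiliary twist — step (c), `L(E^{(d_K)}, 1) ≠ 0 ⟹
corank_{ℤ_p} Sel_{p^∞}(E^{(d_K)}/ℚ) = 0` — is Kato's finiteness theorem (Astérisque 295 (2004),
Cor. 14.3), a theorem about all (modular) elliptic curves over `ℚ`. But the twist `E^{(d_K)}` of a
CM curve is itself a CM curve (`hasCM_quadraticTwist_of_hasCM`: same `j`-invariant), and for CM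
curves that implication is the classical pair Coates–Wiles 1977 (Invent. Math. 39, Thm. 1:
`L(E, 1) ≠ 0 ⟹ E(ℚ)` finite; tree fact `finite_point_of_hasCM_of_L_one_ne_zero`) and Rubin 1987
(Invent. Math. 89, Thm. A with §0 Remark (3): `L(E, 1) ≠ 0 ⟹ Ш(E/ℚ)` finite; tree fact
`shaFinite_of_hasCM_of_L_one_ne_zero`), whence `Sel_{p^∞}` finite (Greenberg 1999 §1, tree theorem
`WeierstrassCurve.finite_selmerGroupPInfty_of_finite_primaryComponent`) — which is the shape of the
PRINTED proof: its rank-zero factor `corank_L H¹_f(K, L(λ*χ/χ*)) = 0` (display (4.4), p. 249 of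
Burungale–Tian) is taken from Rubin's main conjecture for `K` ([38, Thm. 11.1]; "one may also
utilize [28]" = Kolyvagin, i.e. the Euler system of elliptic units / Heegner points in rank zero),
not from Kato. Likewise the parity input of the printed proof (display (4.2), Nekovář [31, Thm. A′])
is used only at the CM curve and the prime of the statement, so as a hypothesis it can be the
`p`-parity fact RESTRICTED to CM curves at good ordinary primes `p ≥ 5` — the case settled before
Dokchitser–Dokchitser (Nekovář 2001 for good ordinary `p`; for CM curves already L. Guo, Math. Ann.
297 (1993)). This Part records route B for CM curves on exactly these inputs:

* `selmerCorank_eq_zero_of_hasCM_of_coatesWiles_rubin` — CM `E/ℚ`, `L(E, 1) ≠ 0 ⟹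
  corank_{ℤ_p} Sel_{p^∞}(E/ℚ) = 0` (any prime `p`), from the two CM facts;
* `analyticRank_eq_one_of_hasCM_of_bcgsCM_of_coatesWiles_rubin_of_rootNumber_eq_neg_one` — Part 3's
  `analyticRank_eq_one_of_hasCM_of_bcgsCM_of_rootNumber_eq_neg_one` with step (c) by Coates–Wiles +
  Rubin at the CM twist instead of Kato;
* `burungaleTian_analyticRank_eq_one_of_selmerCorank_eq_one_of_hasCM_of_bcgsCM_of_cmFacts` — the
  named fact from: `p`-parity for CM curves at good ordinary `p ≥ 5` (`hparCM`), modularity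
  (`hmod`, for Hoffstein–Luo's field and the factorisation of `L(E/K, s)`), Hoffstein–Luo (`hHL`),
  Coates–Wiles (`hCW`), Rubin 1987 (`hRu`) and the CM-restricted `K`-level leaf (`hBCGS_CM`);
* `burungaleTian_analyticRank_eq_one_iff_bcgsCM_of_cmFacts` — modulo Burungale–Tian's rank-zero
  fact and those five inputs, the fact ⟺ the CM-restricted `K`-level leaf (Part 4 without Kato and
  with CM parity only).

So on the CM route neither Kato's theorem nor parity off the CM locus is needed: besides the
`K`-level leaf (for CM curves debt-equivalent to the fact, Part 4) the inputs are modularity,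
Hoffstein–Luo, and four statements about CM curves only (CM parity at good ordinary `p ≥ 5`,
Coates–Wiles, Rubin 1987, Burungale–Tian's rank-zero `p`-converse). -/

section RouteBCMClassical

/-- **`L(E, 1) ≠ 0 ⟹ corank_{ℤ_p} Sel_{p^∞}(E/ℚ) = 0` for a CM curve `E/ℚ`, any prime `p`**, from
Coates–Wiles (`hCW`: `E(ℚ)` finite) and Rubin 1987 (`hRu`: `Ш(E/ℚ)` finite): the contrapositive
of `entireLFunction_one_eq_zero_of_hasCM_of_selmerCorank_ne_zero`
(`BSDSelmerCMPConverseRankOneProofs`, §5). The rank-zero input of route B at the CM twist.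
[cite: CoatesWiles1977, Thm 1] [cite: Rubin1987Sha, Thm. A (p. 527) and §0 Remark (3) (p. 528)]
[cite: Greenberg1999LNM, §1 p. 54] -/
theorem selmerCorank_eq_zero_of_hasCM_of_coatesWiles_rubin
    (hCW : finite_point_of_hasCM_of_L_one_ne_zero) (hRu : shaFinite_of_hasCM_of_L_one_ne_zero)
    (W : WeierstrassCurve ℚ) [W.IsElliptic] (hCM : W.HasCM) (p : ℕ) [Fact p.Prime]
    (hL : W.entireLFunction 1 ≠ 0) : W.selmerCorank p = 0 := by
  by_contra h
  exact hL (entireLFunction_one_eq_zero_of_hasCM_of_selmerCorank_ne_zero hCW hRu W hCM p h)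

/-- **Route B from the sign onwards for a CM curve, with Coates–Wiles + Rubin (1987) at the twist
in place of Kato.** Identical to `analyticRank_eq_one_of_hasCM_of_bcgsCM_of_rootNumber_eq_neg_one`
(Part 3) except for step (c): the Hoffstein–Luo twist `E^{(d_K)}` with `L(E^{(d_K)}, 1) ≠ 0` is a
CM curve (`hasCM_quadraticTwist_of_hasCM`), so `corank_{ℤ_p} Sel_{p^∞}(E^{(d_K)}/ℚ) = 0` by
`selmerCorank_eq_zero_of_hasCM_of_coatesWiles_rubin`. Then `corank Sel_{p^∞}(E/K) = 1 + 0`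
(`selmerCorank_baseChange_quadratic_holds`), (irr) by Serre for CM curves
(`hasIrreducibleModPGaloisRep_of_hasCM_of_five_le`), (tor) from it
(`torsionBy_eq_bot_of_hasIrreducibleModPGaloisRep`), the CM-restricted leaf gives
`ord_{s=1} L(E/K, s) = 1`, and `ord L(E/K) = ord L(E) + ord L(E^{(d_K)}) = ord L(E) + 0`
(`analyticRankEK_eq_add_of`, `analyticRank_eq_zero_of_entireLFunction_one_ne_zero`). This is the
printed architecture of Burungale–Tian §4.2.3 transported to the auxiliary Heegner field: sign
(4.2), auxiliary non-vanishing twist (4.3) (Rohrlich there, Hoffstein–Luo here), rank-zero factor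
by Rubin (4.4), rank-one `K`-level descent, factorisation of the `L`-function.
[cite: BurungaleTian2019, §4.2.3, displays (4.2)–(4.4) (p. 249) and Thm. 1.2 (p. 214)]
[cite: BurungaleEtAl2026, Thm. 1 and Cor. 1 (arXiv:2312.09301, §0.1, pp. 3–4)]
[cite: HoffsteinLuo1997, Theorem (§1, pp. 435–436)] [cite: CoatesWiles1977, Thm 1]
[cite: Rubin1987Sha, Thm. A (p. 527) and §0 Remark (3) (p. 528)] -/
theorem analyticRank_eq_one_of_hasCM_of_bcgsCM_of_coatesWiles_rubin_of_rootNumber_eq_neg_one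
    (hmod : ModularForms.exists_isNewformOf) (hHL : HoffsteinLuo1997_exists_twist_L_one_ne_zero)
    (hCW : finite_point_of_hasCM_of_L_one_ne_zero) (hRu : shaFinite_of_hasCM_of_L_one_ne_zero)
    (hBCGS_CM : ∀ (W : WeierstrassCurve ℚ) [W.IsElliptic] [W.IsGloballyMinimal], W.HasCM →
      ∀ (p : ℕ) [Fact p.Prime],
      3 < p → W.HasGoodReductionAtPrime p → ¬ (p : ℤ) ∣ W.frobeniusTrace p →
      W.HasIrreducibleModPGaloisRep p →
      ∀ (K : Type) [Field K] [NumberField K], IsImaginaryQuadratic K →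
        SatisfiesHeegnerHypothesis (W.conductorNorm ℤ) K →
        Odd (NumberField.discr K) → NumberField.discr K ≠ -3 →
        AddSubgroup.torsionBy (W.baseChange K).toAffine.Point (p : ℤ) = ⊥ →
        SatisfiesHeegnerHypothesis p K →
        (W.baseChange K).selmerCorank p = 1 → analyticRankEK W K = 1)
    (W : WeierstrassCurve ℚ) [W.IsElliptic] [W.IsGloballyMinimal] (hCM : W.HasCM) (p : ℕ)
    [Fact p.Prime] (hp : 5 ≤ p) (hgood : W.HasGoodReductionAtPrime p)
    (hord : ¬ (p : ℤ) ∣ W.frobeniusTrace p) (hw : W.rootNumber = -1)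
    (hcorank : W.selmerCorank p = 1) : W.analyticRank = 1 := by
  have hpP : p.Prime := Fact.out
  -- (b) the auxiliary imaginary quadratic field, from Hoffstein–Luo, with `d_K ≡ 1 (mod 8)`
  obtain ⟨K, _, _, hK, -, hHN, hHp, hd8, hL1⟩ :=
    exists_heegnerField_split_twist_ne_zero_discr_emod_eight_of_hoffsteinLuo hmod hHL W hw hpP 0
  -- (disc): `d_K` odd and `d_K ≠ -3`
  have hodd : Odd (NumberField.discr K) := Int.odd_iff.mpr (by omega)
  have hne3 : NumberField.discr K ≠ -3 := by omega
  -- (c) Coates–Wiles + Rubin 1987 for the CM twist: corank `0`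
  have hd : (NumberField.discr K : ℚ) ≠ 0 := by exact_mod_cast NumberField.discr_ne_zero K
  haveI := W.isElliptic_quadraticTwist hd
  have h0 : (W.quadraticTwist (NumberField.discr K : ℚ)).selmerCorank p = 0 :=
    selmerCorank_eq_zero_of_hasCM_of_coatesWiles_rubin hCW hRu _
      (hasCM_quadraticTwist_of_hasCM W hCM hd) p hL1
  -- (d) the corank over `K` is `1 + 0 = 1`
  have hK1 : (W.baseChange K).selmerCorank p = 1 := by
    rw [selmerCorank_baseChange_quadratic_holds W K hK.1 p, hcorank, h0]
  -- (irr) by Serre for CM curves, (tor) from it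
  have hirr : W.HasIrreducibleModPGaloisRep p :=
    W.hasIrreducibleModPGaloisRep_of_hasCM_of_five_le hCM p hp hgood hord
  have htor : AddSubgroup.torsionBy (W.baseChange K).toAffine.Point (p : ℤ) = ⊥ :=
    torsionBy_eq_bot_of_hasIrreducibleModPGaloisRep W K hK.1 hpP hirr
  -- (e'') the CM-restricted leaf over this `K`
  have hEK : analyticRankEK W K = 1 :=
    hBCGS_CM W hCM p (by omega) hgood hord hirr K hK hHN hodd hne3 htor hHp hK1
  -- (f) factorisation of the analytic rank over `K`
  rw [analyticRankEK_eq_add_of (hasEntireLFunction_rat_of_exists_isNewformOf hmod) W K,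
    analyticRank_eq_zero_of_entireLFunction_one_ne_zero _ hL1, add_zero] at hEK
  exact hEK

/-- **Burungale–Tian's Thm. 1.2 along route B on the classical CM inputs**: the named fact from
`p`-parity for CM curves at good ordinary primes `p ≥ 5` only (`hparCM`: at the curve and prime of
the statement corank `1` gives `w(E) = -1`; printed input (4.2), Nekovář [31, Thm. A′]), the
Modularity Theorem (`hmod`), Hoffstein–Luo (`hHL`), Coates–Wiles (`hCW`), Rubin 1987 (`hRu`) and the
`K`-level leaf for CM curves (`hBCGS_CM`), by
`analyticRank_eq_one_of_hasCM_of_bcgsCM_of_coatesWiles_rubin_of_rootNumber_eq_neg_one`. Compared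
with `burungaleTian_analyticRank_eq_one_of_selmerCorank_eq_one_of_hasCM_of_bcgsCM` (Part 3): no
Kato, and parity only on the fact's own domain. [cite: BurungaleTian2019, Thm. 1.2 (p. 214) and §4.2.3 (p. 249)]
[cite: BurungaleEtAl2026, Thm. 1 and Cor. 1 (arXiv:2312.09301, §0.1, pp. 3–4)]
[cite: CoatesWiles1977, Thm 1] [cite: Rubin1987Sha, Thm. A (p. 527) and §0 Remark (3) (p. 528)] -/
theorem burungaleTian_analyticRank_eq_one_of_selmerCorank_eq_one_of_hasCM_of_bcgsCM_of_cmFacts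
    (hparCM : ∀ (W : WeierstrassCurve ℚ) [W.IsElliptic] [W.IsGloballyMinimal], W.HasCM →
      ∀ (p : ℕ) [Fact p.Prime], 5 ≤ p → W.HasGoodReductionAtPrime p →
        ¬ (p : ℤ) ∣ W.frobeniusTrace p → p_parity W p)
    (hmod : ModularForms.exists_isNewformOf) (hHL : HoffsteinLuo1997_exists_twist_L_one_ne_zero)
    (hCW : finite_point_of_hasCM_of_L_one_ne_zero) (hRu : shaFinite_of_hasCM_of_L_one_ne_zero)
    (hBCGS_CM : ∀ (W : WeierstrassCurve ℚ) [W.IsElliptic] [W.IsGloballyMinimal], W.HasCM →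
      ∀ (p : ℕ) [Fact p.Prime],
      3 < p → W.HasGoodReductionAtPrime p → ¬ (p : ℤ) ∣ W.frobeniusTrace p →
      W.HasIrreducibleModPGaloisRep p →
      ∀ (K : Type) [Field K] [NumberField K], IsImaginaryQuadratic K →
        SatisfiesHeegnerHypothesis (W.conductorNorm ℤ) K →
        Odd (NumberField.discr K) → NumberField.discr K ≠ -3 →
        AddSubgroup.torsionBy (W.baseChange K).toAffine.Point (p : ℤ) = ⊥ →
        SatisfiesHeegnerHypothesis p K →
        (W.baseChange K).selmerCorank p = 1 → analyticRankEK W K = 1) :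
    burungaleTian_analyticRank_eq_one_of_selmerCorank_eq_one_of_hasCM := by
  intro W _ _ hCM p _ hp hgood hord hcorank
  -- (a) parity at `(E, p)`: the root number is `-1`
  have hw : W.rootNumber = -1 := by
    have h := hparCM W hCM p hp hgood hord
    unfold p_parity at h
    rw [hcorank, pow_one] at h
    exact h.symm
  exact analyticRank_eq_one_of_hasCM_of_bcgsCM_of_coatesWiles_rubin_of_rootNumber_eq_neg_one hmod
    hHL hCW hRu hBCGS_CM W hCM p hp hgood hord hw hcorank

/-- **Burungale–Tian's Thm. 1.2 ⟺ the CM-restricted `K`-level leaf, modulo the CM inputs.**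
Granted Burungale–Tian's rank-zero `p`-converse (`h0`), `p`-parity for CM curves at good ordinary
`p ≥ 5` (`hparCM`), the Modularity Theorem (`hmod`), Hoffstein–Luo (`hHL`), Coates–Wiles (`hCW`) and
Rubin 1987 (`hRu`), the rank-one fact is EQUIVALENT to the display of Burungale–Castella–Grossi–
Skinner's Cor. 1 (rank-one case) for CM curves: "⟸" is
`burungaleTian_analyticRank_eq_one_of_selmerCorank_eq_one_of_hasCM_of_bcgsCM_of_cmFacts`, "⟹" is
`bcgsLeaf_of_hasCM_of_burungaleTian` (which uses only `h0` and the continuation of `L(E, s)`).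
Part 4's equivalence with Kato's theorem and parity off the CM locus removed from the list of
inputs. [cite: BurungaleTian2019, Thm. 1.2 (p. 214)] [cite: BurungaleTian2026, Thm. 1.1]
[cite: BurungaleEtAl2026, Cor. 1 (rank-one case; arXiv:2312.09301, §0.1, p. 4)]
[cite: CoatesWiles1977, Thm 1] [cite: Rubin1987Sha, Thm. A (p. 527) and §0 Remark (3) (p. 528)] -/
theorem burungaleTian_analyticRank_eq_one_iff_bcgsCM_of_cmFacts
    (h0 : burungaleTian_analyticRank_eq_zero_of_selmerCorank_eq_zero_of_hasCM)
    (hparCM : ∀ (W : WeierstrassCurve ℚ) [W.IsElliptic] [W.IsGloballyMinimal], W.HasCM →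
      ∀ (p : ℕ) [Fact p.Prime], 5 ≤ p → W.HasGoodReductionAtPrime p →
        ¬ (p : ℤ) ∣ W.frobeniusTrace p → p_parity W p)
    (hmod : ModularForms.exists_isNewformOf) (hHL : HoffsteinLuo1997_exists_twist_L_one_ne_zero)
    (hCW : finite_point_of_hasCM_of_L_one_ne_zero) (hRu : shaFinite_of_hasCM_of_L_one_ne_zero) :
    burungaleTian_analyticRank_eq_one_of_selmerCorank_eq_one_of_hasCM ↔
      ∀ (W : WeierstrassCurve ℚ) [W.IsElliptic] [W.IsGloballyMinimal], W.HasCM →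
        ∀ (p : ℕ) [Fact p.Prime],
        3 < p → W.HasGoodReductionAtPrime p → ¬ (p : ℤ) ∣ W.frobeniusTrace p →
        W.HasIrreducibleModPGaloisRep p →
        ∀ (K : Type) [Field K] [NumberField K], IsImaginaryQuadratic K →
          SatisfiesHeegnerHypothesis (W.conductorNorm ℤ) K →
          Odd (NumberField.discr K) → NumberField.discr K ≠ -3 →
          AddSubgroup.torsionBy (W.baseChange K).toAffine.Point (p : ℤ) = ⊥ →
          SatisfiesHeegnerHypothesis p K →
          (W.baseChange K).selmerCorank p = 1 → analyticRankEK W K = 1 :=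
  ⟨fun h1 ↦ bcgsLeaf_of_hasCM_of_burungaleTian h1 h0
      (hasEntireLFunction_rat_of_exists_isNewformOf hmod),
    fun h ↦ burungaleTian_analyticRank_eq_one_of_selmerCorank_eq_one_of_hasCM_of_bcgsCM_of_cmFacts
      hparCM hmod hHL hCW hRu h⟩

/-- **The printed parity input suffices in its printed scope**: the hypothesis `hparCM` of the two
theorems above is implied by the tree's `p`-parity fact `p_parity` (Dokchitser–Dokchitser 2010,
Thm. 1.4, all `E/ℚ`, all `p`) — recorded so that a discharge `p_parity_holds`, or a CM /
good-ordinary parity theorem of narrower scope (Nekovář 2001, Thm. A′; Guo 1993), feeds route B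
directly. [cite: DokchitserDokchitserAnnals2010, Thm. 1.4] [cite: BurungaleTian2019, display (4.2) (p. 249)] -/
theorem hparCM_of_p_parity
    (hpar : ∀ (W : WeierstrassCurve ℚ) [W.IsElliptic] (p : ℕ) [Fact p.Prime], p_parity W p) :
    ∀ (W : WeierstrassCurve ℚ) [W.IsElliptic] [W.IsGloballyMinimal], W.HasCM →
      ∀ (p : ℕ) [Fact p.Prime], 5 ≤ p → W.HasGoodReductionAtPrime p →
        ¬ (p : ℤ) ∣ W.frobeniusTrace p → p_parity W p :=
  fun W _ _ _ p _ _ _ _ ↦ hpar W p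

end RouteBCMClassical

/-! ## Part 8. The parity input from Nekovář's `p`-parity theorem, as printed

The printed proof takes its parity step — display (4.2), p. 249: "As `corank_{𝒪_℘} Sel_{℘^∞}(A/ℚ)
= 1`, we deduce `ε(1/2, λ) = -1` (4.2) from the parity conjecture due to Nekovář [31, Thm. A′]"
(and p. 217: "As `corank_{ℤ_p} Sel_{p^∞}(E/ℚ) = 1`, the root number of `λ` equals `-1` from the
parity conjecture. In this case, the parity conjecture is due to Nekovář [31]"), [31] = J. Nekovář,
*On the parity of ranks of Selmer groups. II*, C. R. Acad. Sci. Paris 332 (2001). The tree carries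
Nekovář's later `p`-parity theorem as the named fact `Nekovar2013_theoremA`
(`SelmerParityTotallyReal`; Algebra & Number Theory 7 (2013), Thm. A: `s_p(E/F) ≡ r_an(E/F)
(mod 2)` for `E` over a totally real `F` in the cases (1) no CM, (2) CM and `[F:ℚ]` odd, (3) CM
with `p` split in the CM field, for `L(E/F, s)` entire), whose case `F = ℚ` (degree `1`: cases
(1)–(2)) is the `p`-parity theorem for every `E/ℚ` and every prime `p`
(`selmerCorank_mod_two_eq_of_nekovar`, given the continuation of `L(E, s)`). This Part feeds the
parity hypotheses of route B from that fact and the Modularity Theorem (which supplies the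
continuation, `hasEntireLFunction_rat_of_exists_isNewformOf`, and the passage from the analytic
form `corank ≡ ord_{s=1} L(E,s) (mod 2)` to the root-number form `(-1)^{corank} = w(E)`,
`p_parity_of_selmerCorank_mod_two_eq_of_exists_isNewformOf` — `w(E) = (-1)^{ord_{s=1} L(E,s)}` by
the functional equation):

* `hpar_of_nekovar` — `p_parity W p` for every `E/ℚ` and every `p` (the hypothesis `hpar` of
  `burungaleTian_analyticRank_eq_one_of_selmerCorank_eq_one_of_hasCM_of_bcgsCM`, Part 3, and of
  `BSDSelmerCMPConverseHeegnerFieldProofs`); `hparCM_of_nekovar` — its restriction `hparCM` to CM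
  curves at good ordinary `p ≥ 5` (Part 7);
* `burungaleTian_analyticRank_eq_one_of_selmerCorank_eq_one_of_hasCM_of_bcgsCM_of_nekovar` — the
  fact from `Nekovar2013_theoremA`, the Modularity Theorem, Hoffstein–Luo, Coates–Wiles, Rubin 1987
  and the CM-restricted `K`-level leaf (Part 7's `…_of_cmFacts` with its parity hypothesis so
  discharged): along route B every `ℚ`-level input of the printed architecture is now a NAMED FACT
  of the tree taken from the printed source or its CM-classical counterpart — parity (4.2)
  (Nekovář), auxiliary non-vanishing twist (4.3) (Hoffstein–Luo in place of Rohrlich), rank-zero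
  factor (4.4) (Coates–Wiles + Rubin 1987 in place of Rubin's main conjecture [38, Thm. 11.1]),
  continuation and factorisation of the `L`-function (modularity) — and the one inline input left
  is the `K`-level rank-one descent (for CM curves debt-equivalent to the fact, Part 4);
* `burungaleTian_analyticRank_eq_one_iff_bcgsCM_of_nekovar` — Part 7's equivalence on these inputs.
-/

section NekovarParity

/-- **`p`-parity for every `E/ℚ` and every `p` from Nekovář 2013, Thm. A, and the Modularity
Theorem**, in the root-number form `p_parity W p` (`(-1)^{corank_{ℤ_p} Sel_{p^∞}(E/ℚ)} = w(E)`):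
Theorem A's case `F = ℚ` gives `corank ≡ ord_{s=1} L(E,s) (mod 2)`
(`selmerCorank_mod_two_eq_of_nekovar`, with the continuation of `L(E,s)` from modularity,
`hasEntireLFunction_rat_of_exists_isNewformOf`), and `w(E) = (-1)^{ord_{s=1} L(E,s)}` by the
functional equation (`p_parity_of_selmerCorank_mod_two_eq_of_exists_isNewformOf`). The hypothesis
`hpar` of route B (Part 3; `BSDSelmerCMPConverseHeegnerFieldProofs`).
[cite: Nekovar2013, Thm. A (1)–(2) (p. 1101)] [cite: BCDTJAMS2001, Thm. A] -/
theorem hpar_of_nekovar (hN : Nekovar2013_theoremA) (hmod : ModularForms.exists_isNewformOf)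
    (W : WeierstrassCurve ℚ) [W.IsElliptic] (p : ℕ) [Fact p.Prime] : p_parity W p :=
  p_parity_of_selmerCorank_mod_two_eq_of_exists_isNewformOf W p hmod
    (selmerCorank_mod_two_eq_of_nekovar hN (hasEntireLFunction_rat_of_exists_isNewformOf hmod) W p)

/-- **The printed parity input (4.2) from Nekovář's theorem**: the hypothesis `hparCM` of Part 7
(`p`-parity at CM curves and good ordinary primes `p ≥ 5`, the scope in which Burungale–Tian use
"the parity conjecture due to Nekovář [31, Thm. A′]", p. 249) from `Nekovar2013_theoremA` and the
Modularity Theorem, by restriction of `hpar_of_nekovar`.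
[cite: BurungaleTian2019, display (4.2) (p. 249) and p. 217] [cite: Nekovar2013, Thm. A (p. 1101)] -/
theorem hparCM_of_nekovar (hN : Nekovar2013_theoremA) (hmod : ModularForms.exists_isNewformOf) :
    ∀ (W : WeierstrassCurve ℚ) [W.IsElliptic] [W.IsGloballyMinimal], W.HasCM →
      ∀ (p : ℕ) [Fact p.Prime], 5 ≤ p → W.HasGoodReductionAtPrime p →
        ¬ (p : ℤ) ∣ W.frobeniusTrace p → p_parity W p :=
  fun W _ _ _ p _ _ _ _ ↦ hpar_of_nekovar hN hmod W p

/-- **Burungale–Tian's Thm. 1.2 along route B with the parity step from Nekovář's theorem**: the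
named fact from `Nekovar2013_theoremA` (parity, printed input (4.2)), the Modularity Theorem
(`hmod`), Hoffstein–Luo (`hHL`, the auxiliary twist (4.3)), Coates–Wiles (`hCW`) and Rubin 1987
(`hRu`) (the rank-zero factor (4.4)) and the CM-restricted `K`-level leaf (`hBCGS_CM`, the
rank-one descent), by Part 7's
`burungaleTian_analyticRank_eq_one_of_selmerCorank_eq_one_of_hasCM_of_bcgsCM_of_cmFacts` with
`hparCM := hparCM_of_nekovar hN hmod`. Every `ℚ`-level input is a named fact of the tree.
[cite: BurungaleTian2019, Thm. 1.2 (p. 214) and §4.2.3, displays (4.2)–(4.4) (p. 249)]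
[cite: Nekovar2013, Thm. A (p. 1101)]
[cite: BurungaleEtAl2026, Thm. 1 and Cor. 1 (arXiv:2312.09301, §0.1, pp. 3–4)]
[cite: HoffsteinLuo1997, Theorem (§1, pp. 435–436)] [cite: CoatesWiles1977, Thm 1]
[cite: Rubin1987Sha, Thm. A (p. 527) and §0 Remark (3) (p. 528)] -/
theorem burungaleTian_analyticRank_eq_one_of_selmerCorank_eq_one_of_hasCM_of_bcgsCM_of_nekovar
    (hN : Nekovar2013_theoremA) (hmod : ModularForms.exists_isNewformOf)
    (hHL : HoffsteinLuo1997_exists_twist_L_one_ne_zero)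
    (hCW : finite_point_of_hasCM_of_L_one_ne_zero) (hRu : shaFinite_of_hasCM_of_L_one_ne_zero)
    (hBCGS_CM : ∀ (W : WeierstrassCurve ℚ) [W.IsElliptic] [W.IsGloballyMinimal], W.HasCM →
      ∀ (p : ℕ) [Fact p.Prime],
      3 < p → W.HasGoodReductionAtPrime p → ¬ (p : ℤ) ∣ W.frobeniusTrace p →
      W.HasIrreducibleModPGaloisRep p →
      ∀ (K : Type) [Field K] [NumberField K], IsImaginaryQuadratic K →
        SatisfiesHeegnerHypothesis (W.conductorNorm ℤ) K →
        Odd (NumberField.discr K) → NumberField.discr K ≠ -3 →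
        AddSubgroup.torsionBy (W.baseChange K).toAffine.Point (p : ℤ) = ⊥ →
        SatisfiesHeegnerHypothesis p K →
        (W.baseChange K).selmerCorank p = 1 → analyticRankEK W K = 1) :
    burungaleTian_analyticRank_eq_one_of_selmerCorank_eq_one_of_hasCM :=
  burungaleTian_analyticRank_eq_one_of_selmerCorank_eq_one_of_hasCM_of_bcgsCM_of_cmFacts
    (hparCM_of_nekovar hN hmod) hmod hHL hCW hRu hBCGS_CM

/-- **Burungale–Tian's Thm. 1.2 ⟺ the CM-restricted `K`-level leaf, modulo Burungale–Tian's
rank-zero fact, Nekovář's parity theorem, modularity, Hoffstein–Luo, Coates–Wiles and Rubin 1987**: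
Part 7's `burungaleTian_analyticRank_eq_one_iff_bcgsCM_of_cmFacts` with the parity hypothesis from
`Nekovar2013_theoremA` (`hparCM_of_nekovar`). All six standing inputs are named facts of the tree.
[cite: BurungaleTian2019, Thm. 1.2 (p. 214)] [cite: BurungaleTian2026, Thm. 1.1]
[cite: Nekovar2013, Thm. A (p. 1101)]
[cite: BurungaleEtAl2026, Cor. 1 (rank-one case; arXiv:2312.09301, §0.1, p. 4)] -/
theorem burungaleTian_analyticRank_eq_one_iff_bcgsCM_of_nekovar
    (h0 : burungaleTian_analyticRank_eq_zero_of_selmerCorank_eq_zero_of_hasCM)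
    (hN : Nekovar2013_theoremA) (hmod : ModularForms.exists_isNewformOf)
    (hHL : HoffsteinLuo1997_exists_twist_L_one_ne_zero)
    (hCW : finite_point_of_hasCM_of_L_one_ne_zero) (hRu : shaFinite_of_hasCM_of_L_one_ne_zero) :
    burungaleTian_analyticRank_eq_one_of_selmerCorank_eq_one_of_hasCM ↔
      ∀ (W : WeierstrassCurve ℚ) [W.IsElliptic] [W.IsGloballyMinimal], W.HasCM →
        ∀ (p : ℕ) [Fact p.Prime],
        3 < p → W.HasGoodReductionAtPrime p → ¬ (p : ℤ) ∣ W.frobeniusTrace p →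
        W.HasIrreducibleModPGaloisRep p →
        ∀ (K : Type) [Field K] [NumberField K], IsImaginaryQuadratic K →
          SatisfiesHeegnerHypothesis (W.conductorNorm ℤ) K →
          Odd (NumberField.discr K) → NumberField.discr K ≠ -3 →
          AddSubgroup.torsionBy (W.baseChange K).toAffine.Point (p : ℤ) = ⊥ →
          SatisfiesHeegnerHypothesis p K →
          (W.baseChange K).selmerCorank p = 1 → analyticRankEK W K = 1 :=
  burungaleTian_analyticRank_eq_one_iff_bcgsCM_of_cmFacts h0 (hparCM_of_nekovar hN hmod) hmod hHL
    hCW hRu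

end NekovarParity

end Literature.NumberTheory.EllipticCurves

end
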